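import Literature.NumberTheory.GaloisRepresentations.GaloisCohomologyInflationColimit
import Literature.NumberTheory.GaloisRepresentations.HomDualLocalPairingPlace
import Literature.NumberTheory.GaloisRepresentations.IdeleLocalInvariantsPlaceSum
import Literature.NumberTheory.GaloisRepresentations.PresentationCocycleTransportPlaces
import Literature.NumberTheory.GaloisRepresentations.UnramifiedClassesInertia
import Literature.AlgebraicTopology.SingularHomology.KroneckerInjectiveSelfInjective
import Literature.NumberTheory.EllipticCurves.ArchimedeanKummerImageMaximal
import Literature.NumberTheory.GaloisRepresentations.FrobeniusQuotientHOne
import Literature.Algebra.Homology.ExtPresentationBoundary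
import Literature.NumberTheory.GaloisRepresentations.HomDualIdeleReadout
import HarnessLib

/-!
# Poitou–Tate duality for finite modules, 3/7: unramified local conditions, local pairings on unramified classes, bidual transport, the all-places reduction, presentation read-out, the reciprocity equality (re-homed proofs)

**Poitou–Tate duality for finite Galois modules over number fields and its consequences, proved in the tree's vocabulary from the idèle
class formation (Milne, *Arithmetic Duality Theorems* I §2, §4; Tate, ICM 1962; Harari 2020 Ch. 17–18; Serre, Durham 1977 §6): the named facts
`Literature.NumberTheory.GaloisCohomology.poitouTate_sha_tateDual` (PT (ii): `Ш¹(K, M)` and `Ш¹(K, M^D)` are exact annihilators, `PoitouTateSha.lean`),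
`…poitouTate_sha_zmod_mu` (its `ℤ/m` / `μ_m` instance), `…poitouTate_three_realPlaces_injective` (Milne I Thm. 4.10 (c), degree 3,
`PoitouTateRealPlacesHigherDegree.lean`), `…poitouTate_selmerStructure_duality_conj` (duality for Selmer structures with conjugation-compatible
canonical invariants, `PoitouTateSelmerStructuresConj.lean`), `Literature.NumberTheory.GaloisRepresentations.Patrikis2019_exists_lift_projective` / `…_exists_spinLift` /
`…_exists_spinLift_of_continuous` (Tate's `H²(Γ_K, ℚ/ℤ) = 0` and Patrikis' lifting statements, `ProjectiveLifting.lean`, `TateSpinLift.lean`,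
`TateSpinLiftContinuous.lean`) and `Literature.NumberTheory.GaloisCohomology.Howard2004.prop141_casselsTate_skewPairing_atLevel_printIntended` /
`…thm161_dvrKolyvaginBound_printIntended` (Howard 2004 Prop. 1.4.1 / Thm. 1.6.1 as intended, `Howard2004/`) HOLD — EXACT names `<fact>_holds`
(files 2 and 7 of 7).**  Contents: (1, definitions file) annihilators under a perfect `ℤ/n`-valued pairing of finite abelian groups and their counting
(Milne I §0), descent of `2`-cocycles through an open normal subgroup, the trivial module `ℤ/m` versus `μ_m` (transport maps); (2) `Ш³` and
`H³(K, M) → ⊕_{v real}` injectivity via the Brauer group (`H³(Γ_K, K̄ˣ) = 0`, odd descent, Sylow fields); (3) unramified local conditions,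
inertia and the unramified subgroup, local Tate pairing vanishing on unramified classes, exact orthogonality at almost all places, bidual transport,
the all-places reduction, presentation read-out and the reciprocity equality; (4) finiteness of Selmer groups, finite duality of `Ш`-duals, new places,
`Ш²` read-out roads, weak Leopoldt; (5) the real-place corrections, native `Ш²` assembly, presentation pairings, the idèle package and the reciprocity
sum; (6) local duality at every place, the Selmer-complement reduction, unramified orthogonality at all levels, the all-places reduction, the
middle-exact dual symmetry; (7) `Ш¹`-duality `poitouTate_sha_tateDual_holds`, the `ℤ/m`–`μ_m` instance, `H²`-finite support, Tate's theorem
`H²(Γ_K, ℚ/ℤ) = 0` for every number field and the Patrikis / Howard / Selmer-structure discharges.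
RE-HOMED into `Literature/` by the Hodge foundations lane (`lit-hodgefound`, seat p20, generation 40): verbatim DECLARATION-LEVEL ports (the 221
declarations needed, in dependency order; each Part is a slice of one Summits module) of 63 modules
`Summits/BirchSwinnertonDyer/BirchSwinnertonDyer/Theorems/{SchneiderFreeAdditiveX3PoitouTate*,SchneiderFreeAdditiveX3TateH2VanishingAllNumberFields,
CumulativeHeegnerLeopoldtRedSplitControlAtThreeSha*,ThetaPartnerAtTwoSignedControlAtTwo{MuReal*,ShaTwo*,ShaThree*,GlobalHTwoFiniteSupport},
KolyvaginRoadThreePTDevissageCofinite,PoitouTateSelmerStructureDualityConjHolds,Howard{Thm161PrintIntendedOfProp141Intended,FlachSkewPairingAtLevelIntendedHolds}}.lean`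
and `Summits/BirchSwinnertonDyer/Rank1Residual/{X11b,GaloisImage}/*.lean`; the namespaces `Summit.BirchSwinnertonDyer.BirchSwinnertonDyer.Theorems[.SchneiderFreeAdditiveX3]`
and `Summit.BirchSwinnertonDyer.Rank1Residual` are re-rooted at `Literature.NumberTheory.GaloisCohomology.PoitouTateFinite` (sub-namespaces `PoitouTateReduction`,
`PoitouTateShaTwoReadout`, `PoitouTateShaAnnihilator`, `SignedEC.*`, `KolyvaginRoadThreePT`, `InputsPoitouTateSelmer`, `Howard*`, `GaloisImage.*` kept; the route-item
segment `X11b` is dropped: `…X11b.{FiniteDuality,Levels,LocBridge,H2Support,ShaBound,WeakLeopoldt}` ↦ `PoitouTateFinite.{…}`);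
four lemmas of `X11b/MaxUnramifiedRestriction.lean` already in `Literature/NumberTheory/GaloisRepresentations/UnramifiedClassesInertia.lean` are used from
there; the nine `_holds` theorems carry the EXACT names.  Built on the tree's Literature layer (`Literature/NumberTheory/{GaloisRepresentations,GaloisCohomology,
Automorphic,EllipticCurves}/…`, `Literature/Algebra/Homology/…`, `Literature/AnabelianGeometry/AbsoluteAnabelian/…`).  No new named fact (D-0026); imports
Mathlib/Literature only; every declaration carries the citation of the printed statement it formalises or serves.  The Summits originals stay in
place (transitional duplication).  WHAT THIS IS NOT: nothing here bears on the Birch–Swinnerton-Dyer conjecture or any summit statement; it is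
classical Poitou–Tate duality for finite modules (1960s) re-proved in the tree's vocabulary.
-/

noncomputable section

/-!
## Part 1 — port of `Summits/BirchSwinnertonDyer/BirchSwinnertonDyer/Theorems/SchneiderFreeAdditiveX3PoitouTateLocalDualityEveryPlace.lean` (9 declarations kept)

# Poitou–Tate toolkit (1/3): annihilators of meets, sums of perfect pairings, and local Tate duality at EVERY place of a number field

Declarations of this Part (verbatim port; each keeps its own docstring and citation): `exists_piPairing`, `piPairing_single_right`, `piPairing_single_left`, `piPairing_injective`, `piPairing_flip_injective`, `pi_nsmul_eq_zero`, `finite_galoisCohomology_one_toLocal_place`, `finite_galoisCohomology_one_tateDual_toLocal_place`, `bijective_localTatePairingZMod_place`.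

Reference keys (see `references.bib` and the declarations' citations): [MilneADT2006].
-/

section Part1

open _root_.Function _root_.NumberField _root_.IsDedekindDomain
open scoped _root_.NumberField

universe u

namespace Literature.NumberTheory.GaloisCohomology.PoitouTateFinite.PoitouTateReduction

section PiPairing

variable {ι : Type*} [Fintype ι] [DecidableEq ι] {A B : ι → Type*} [∀ i, AddCommGroup (A i)]
  [∀ i, AddCommGroup (B i)] {n : ℕ}

omit [DecidableEq ι] in
/-- **The sum pairing of a finite family of pairings** `b(p, q) = ∑ᵢ eᵢ(pᵢ, qᵢ)` on `Πᵢ Aᵢ × Πᵢ Bᵢ`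
exists as a bi-additive map (the pairing on `⊕_{v ∈ S} H¹(K_v, M) × ⊕_{v ∈ S} H¹(K_v, M^D)` of Milne I §4,
`P¹_S(K, M) × P¹_S(K, M^D) → ℤ/n`). [cite: MilneADT2006, Ch. I §0 (pairings; dual of a finite group), Prop. 0.19] -/
theorem exists_piPairing (e : ∀ i, A i →+ B i →+ ZMod n) :
    ∃ b : (Π i, A i) →+ (Π i, B i) →+ ZMod n, ∀ p q, b p q = ∑ i, e i (p i) (q i) := by
  refine ⟨∑ i, ((e i).comp (Pi.evalAddMonoidHom A i)).compl₂ (Pi.evalAddMonoidHom B i), fun p q => ?_⟩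
  rw [AddMonoidHom.finsetSum_apply, AddMonoidHom.finsetSum_apply]
  rfl

variable {e : ∀ i, A i →+ B i →+ ZMod n} {b : (Π i, A i) →+ (Π i, B i) →+ ZMod n}

/-- Value of the sum pairing on a vector supported at one index (right). [cite: MilneADT2006, Ch. I §0 (pairings; dual of a finite group), Prop. 0.19] -/
theorem piPairing_single_right (hb : ∀ p q, b p q = ∑ i, e i (p i) (q i)) (p : Π i, A i) (i : ι)
    (y : B i) : b p (Pi.single i y) = e i (p i) y := by
  rw [hb, Finset.sum_eq_single i]
  · rw [Pi.single_eq_same]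
  · intro j _ hj
    rw [Pi.single_eq_of_ne hj, map_zero]
  · intro h
    exact absurd (Finset.mem_univ i) h

/-- Value of the sum pairing on a vector supported at one index (left). [cite: MilneADT2006, Ch. I §0 (pairings; dual of a finite group), Prop. 0.19] -/
theorem piPairing_single_left (hb : ∀ p q, b p q = ∑ i, e i (p i) (q i)) (i : ι) (x : A i)
    (q : Π i, B i) : b (Pi.single i x) q = e i x (q i) := by
  rw [hb, Finset.sum_eq_single i]
  · rw [Pi.single_eq_same]
  · intro j _ hj
    rw [Pi.single_eq_of_ne hj, map_zero, AddMonoidHom.zero_apply]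
  · intro h
    exact absurd (Finset.mem_univ i) h

/-- The left adjoint of a sum of pairings with injective left adjoints is injective. [cite: MilneADT2006, Ch. I §0 (pairings; dual of a finite group), Prop. 0.19] -/
theorem piPairing_injective (hb : ∀ p q, b p q = ∑ i, e i (p i) (q i))
    (hinj : ∀ i, Injective (e i)) : Injective b := by
  refine (injective_iff_map_eq_zero b).mpr fun p hp => funext fun i => ?_
  refine (injective_iff_map_eq_zero (e i)).mp (hinj i) (p i) (AddMonoidHom.ext fun y => ?_)
  rw [← piPairing_single_right hb p i y, hp, AddMonoidHom.zero_apply, AddMonoidHom.zero_apply]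

/-- The right adjoint of a sum of pairings with injective right adjoints is injective. [cite: MilneADT2006, Ch. I §0 (pairings; dual of a finite group), Prop. 0.19] -/
theorem piPairing_flip_injective (hb : ∀ p q, b p q = ∑ i, e i (p i) (q i))
    (hinj : ∀ i, Injective (e i).flip) : Injective b.flip := by
  refine (injective_iff_map_eq_zero b.flip).mpr fun q hq => funext fun i => ?_
  refine (injective_iff_map_eq_zero (e i).flip).mp (hinj i) (q i) (AddMonoidHom.ext fun x => ?_)
  rw [AddMonoidHom.flip_apply, ← piPairing_single_left hb i x q, ← AddMonoidHom.flip_apply b, hq,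
    AddMonoidHom.zero_apply, AddMonoidHom.zero_apply]

omit [Fintype ι] [DecidableEq ι] in
/-- The product of groups killed by `n` is killed by `n`. [cite: MilneADT2006, Ch. I §0 (pairings; dual of a finite group), Prop. 0.19] -/
theorem pi_nsmul_eq_zero (hA : ∀ i (x : A i), n • x = 0) (p : Π i, A i) : n • p = 0 :=
  funext fun i => by rw [Pi.smul_apply, Pi.zero_apply, hA i]

end PiPairing

section LocalPerfect

open _root_.Field
open Literature.NumberTheory.GaloisRepresentations Literature.NumberTheory.GaloisCohomology
open Literature.NumberTheory.GaloisRepresentations.DiscreteGaloisModule (mu localTatePairingZMod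
  tateDual SelmerStructure unramifiedSubgroup)

variable {K : Type u} [Field K] [NumberField K] {n : ℕ} [NeZero n]
variable {M : Type u} [AddCommGroup M] [TopologicalSpace M] [DiscreteTopology M] [Finite M]

omit [NeZero n] in
/-- `H¹(K_v, M)` is finite at EVERY place `v` of a number field (finite `M`): at the finite places the
tree's `finite_galoisCohomology_one_toLocal` (Milne I Cor. 2.3), at the infinite places `Γ_{K_v}` is
finite. [cite: MilneADT2006, Ch. I, Cor. 2.3 and Thm. 2.13] -/
theorem finite_galoisCohomology_one_toLocal_place (ρ : DiscreteGaloisModule K M) (v : Place K) :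
    Finite (galoisCohomology (ρ.toLocal v) 1) := by
  rcases v with w | v
  · haveI := finite_absoluteGaloisGroup_placeCompletion_inl K w
    exact finite_galoisCohomology_one_of_finite_absoluteGaloisGroup (ρ.toLocal (Sum.inl w))
  · exact finite_galoisCohomology_one_toLocal ρ v

/-- `H¹(K_v, M^D)` is finite at every place. [cite: MilneADT2006, Ch. I, Cor. 2.3 and Thm. 2.13] -/
theorem finite_galoisCohomology_one_tateDual_toLocal_place (ρ : DiscreteGaloisModule K M)
    (v : Place K) : Finite (galoisCohomology ((ρ.tateDual n).toLocal v) 1) :=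
  haveI := DiscreteGaloisModule.TateDual.finite K M n
  finite_galoisCohomology_one_toLocal_place (ρ.tateDual n) v

/-- **Local Tate duality at every place.**  For a family of local invariant maps which is perfect at
the finite places (`IsPerfect`, Milne I Cor. 2.3) and injective at the real places
(`InjectiveAtRealPlaces`, Milne I Ex. 1.6 (c) with Thm. 2.13 (a)), both adjoints of
`⟨·, ·⟩_v = inv_v (· ∪ ·) : H¹(K_v, M) × H¹(K_v, M^D) → ℤ/n` are bijective at EVERY place `v` (at a
complex place both groups vanish). [cite: MilneADT2006, Ch. I, Cor. 2.3 and Thm. 2.13 (a)] -/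
theorem bijective_localTatePairingZMod_place (inv : LocalInvariants K n) (hperf : inv.IsPerfect)
    (hreal : inv.InjectiveAtRealPlaces) (ρ : DiscreteGaloisModule K M) (hM : ∀ m : M, n • m = 0)
    (v : Place K) :
    Bijective (localTatePairingZMod ρ n v (inv v)) ∧
      Bijective (localTatePairingZMod ρ n v (inv v)).flip := by
  rcases v with w | v
  · rcases w.isReal_or_isComplex with hw | hw
    · exact bijective_localTatePairingZMod_inl ρ n hM w (inv (Sum.inl w)) (hreal.injective hw)
    · haveI : Subsingleton (absoluteGaloisGroup (Place.Completion (K := K) (Sum.inl w))) :=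
        ⟨fun a c => (eq_one_absoluteGaloisGroup_of_isComplex hw a).trans
          (eq_one_absoluteGaloisGroup_of_isComplex hw c).symm⟩
      have hx : ∀ x : galoisCohomology (ρ.toLocal (Sum.inl w)) 1, x = 0 :=
        galoisCohomology_one_eq_zero_of_subsingleton _
      have hy : ∀ y : galoisCohomology ((ρ.tateDual n).toLocal (Sum.inl w)) 1, y = 0 :=
        galoisCohomology_one_eq_zero_of_subsingleton _
      refine ⟨⟨fun a c _ => (hx a).trans (hx c).symm, fun f => ⟨0, ?_⟩⟩,
        ⟨fun a c _ => (hy a).trans (hy c).symm, fun f => ⟨0, ?_⟩⟩⟩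
      · rw [map_zero]
        exact AddMonoidHom.ext fun y => by rw [hy y, map_zero, map_zero]
      · rw [map_zero]
        exact AddMonoidHom.ext fun x => by rw [hx x, map_zero, map_zero]
  · exact (hperf v).2 ρ hM

end LocalPerfect

end Literature.NumberTheory.GaloisCohomology.PoitouTateFinite.PoitouTateReduction

end Part1

/-!
## Part 2 — port of `Summits/BirchSwinnertonDyer/Rank1Residual/GaloisImage/UnramifiedCupProductVanishing.lean` (4 declarations kept)

# Cup products of classes inflated from a quotient `Γ/N` with `H²(Γ/N, ·) = 0` vanish

Declarations of this Part (verbatim port; each keeps its own docstring and citation): `apply_mem_invariantsOf_of_vanishing`, `apply_mul_eq_of_vanishing`, `exists_quotient_cocycle`, `cupClass_eq_zero_of_vanishing_of_subsingleton`.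

Reference keys (see `references.bib` and the declarations' citations): [SerreGaloisCohomology1997], [MilneADT2006].
-/

section Part2

open _root_.CategoryTheory _root_.Function
open scoped ContRepresentation

universe v

namespace Literature.NumberTheory.GaloisCohomology.PoitouTateFinite.GaloisImage

namespace UnramifiedCup

open Literature.NumberTheory.GaloisRepresentations
open _root_.TopRep _root_.ContRepresentation _root_.ContinuousCohomology

section Abstract

variable {Γ : Type v} [Group Γ] [TopologicalSpace Γ] [IsTopologicalGroup Γ] [CompactSpace Γ]
variable {M₁ M₂ M₃ : Type v}
  [AddCommGroup M₁] [TopologicalSpace M₁] [DiscreteTopology M₁]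
  [AddCommGroup M₂] [TopologicalSpace M₂] [DiscreteTopology M₂]
  [AddCommGroup M₃] [TopologicalSpace M₃] [DiscreteTopology M₃]
variable (N : Subgroup Γ) [N.Normal]
variable (ρ₁ : ContinuousRep Γ ℤ M₁) (ρ₂ : ContinuousRep Γ ℤ M₂) (ρ₃ : ContinuousRep Γ ℤ M₃)

omit [IsTopologicalGroup Γ] [CompactSpace Γ] in
/-- The values of a crossed homomorphism vanishing on a normal subgroup `N` lie in `M^N`
(`f(nx) = n·f(x)` and `nx = x·(x⁻¹nx)`). [cite: SerreGaloisCohomology1997, I §2.6 (b)] -/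
theorem apply_mem_invariantsOf_of_vanishing (f : contOneCocycles ρ₁.toTopRep)
    (hf : ∀ n ∈ N, f.1 n = 0) (x : Γ) : f.1 x ∈ ρ₁.invariantsOf N := by
  rw [ContinuousRep.mem_invariantsOf_iff]
  intro n
  have h1 : f.1 ((n : Γ) * x) = ρ₁ n (f.1 x) := by
    rw [f.2, hf n n.2, zero_add]; rfl
  have hn' : x⁻¹ * n * x ∈ N := by
    simpa [mul_assoc] using (inferInstance : N.Normal).conj_mem' n n.2 x
  have h2 : f.1 ((n : Γ) * x) = f.1 x := by
    rw [show (n : Γ) * x = x * (x⁻¹ * n * x) by rw [mul_assoc x⁻¹, mul_inv_cancel_left],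
      f.2 x, hf _ hn', map_zero, add_zero]
  rw [← h1, h2]

omit [IsTopologicalGroup Γ] [CompactSpace Γ] [N.Normal] in
/-- A crossed homomorphism vanishing on `N` is constant on left `N`-cosets: `f(xn) = f(x)`. [cite: SerreGaloisCohomology1997, I §2.6 (b)] -/
theorem apply_mul_eq_of_vanishing (f : contOneCocycles ρ₁.toTopRep)
    (hf : ∀ n ∈ N, f.1 n = 0) (x : Γ) {n : Γ} (hn : n ∈ N) : f.1 (x * n) = f.1 x := by
  rw [f.2 x n, hf n hn, map_zero, add_zero]

omit [CompactSpace Γ] in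
/-- **A crossed homomorphism vanishing on `N` factors through `Γ/N`**: there is a continuous crossed
homomorphism `f̄` of the discrete `Γ/N`-module `M^N` with `f̄(xN) = f(x)` (the inverse of inflation on
cocycles; continuity by `Continuous.quotient_lift`). [cite: SerreGaloisCohomology1997, I §2.6 (b)] -/
theorem exists_quotient_cocycle (f : contOneCocycles ρ₁.toTopRep) (hf : ∀ n ∈ N, f.1 n = 0) :
    ∃ fbar : contOneCocycles (ρ₁.quotientInvariants N).toTopRep,
      ∀ x : Γ, ((fbar.1 (x : Γ ⧸ N) : ρ₁.invariantsOf N) : M₁) = f.1 x := by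
  -- the set-theoretic lift
  let F : Γ → ρ₁.invariantsOf N := fun x => ⟨f.1 x, apply_mem_invariantsOf_of_vanishing N ρ₁ f hf x⟩
  have hF : ∀ x y : Γ, QuotientGroup.leftRel N x y → F x = F y := by
    intro x y hxy
    rw [QuotientGroup.leftRel_apply] at hxy
    apply Subtype.ext
    change f.1 x = f.1 y
    rw [show y = x * (x⁻¹ * y) by rw [mul_inv_cancel_left], apply_mul_eq_of_vanishing N ρ₁ f hf x hxy]
  have hFc : Continuous F := f.1.continuous.subtype_mk _
  let Fbar : C(Γ ⧸ N, ρ₁.invariantsOf N) := ⟨Quotient.lift F hF, hFc.quotient_lift hF⟩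
  have hFbar : ∀ x : Γ, Fbar (x : Γ ⧸ N) = F x := fun _ => rfl
  refine ⟨⟨Fbar, fun p q => ?_⟩, fun x => rfl⟩
  induction p using QuotientGroup.induction_on with
  | H x =>
    induction q using QuotientGroup.induction_on with
    | H y =>
      rw [← QuotientGroup.mk_mul, hFbar, hFbar, hFbar]
      apply Subtype.ext
      change f.1 (x * y) = f.1 x + ((ρ₁.quotientInvariants N (x : Γ ⧸ N) (F y) : ρ₁.invariantsOf N) : M₁)
      rw [ContinuousRep.quotientInvariants_apply_coe, f.2 x y]
      rfl

/-- **Cup products of classes inflated from a quotient with vanishing `H²` are zero.**  For a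
compact topological group `Γ`, a normal subgroup `N`, a continuous equivariant pairing
`φ : M₁ × M₂ → M₃` of discrete `Γ`-modules with `H²(Γ/N, M₃^N) = 0`, and continuous crossed
homomorphisms `f`, `g` VANISHING on `N`: `[f ∪ g] = 0` in `H²(Γ, M₃)`.  Proof at cochain level:
`f`, `g` factor through crossed homomorphisms `f̄`, `ḡ` of `M₁^N`, `M₂^N` over `Γ/N`
(`exists_quotient_cocycle`); `φ` restricts to a pairing `M₁^N × M₂^N → M₃^N` of `Γ/N`-modules; the
homogeneous `2`-cocycle `f̄ ∪ ḡ` is a coboundary `dτ̄` (`Subsingleton`, `cxClass_eq_zero_iff`), and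
the invariant `1`-cochain `(x, y) ↦ τ̄(xN, yN)` bounds `f ∪ g`.
[cite: MilneADT2006, Ch. I, Thm. 2.6 (proof)] [cite: SerreGaloisCohomology1997, I §2.6 (b)] -/
theorem cupClass_eq_zero_of_vanishing_of_subsingleton
    (φ : ContPairing ρ₁.toTopRep ρ₂.toTopRep ρ₃.toTopRep)
    [h2 : Subsingleton (continuousCohomology 2 (ρ₃.quotientInvariants N).toTopRep)]
    (f : contOneCocycles ρ₁.toTopRep) (g : contOneCocycles ρ₂.toTopRep)
    (hf : ∀ n ∈ N, f.1 n = 0) (hg : ∀ n ∈ N, g.1 n = 0) : φ.cupClass f g = 0 := by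
  classical
  obtain ⟨fb, hfb⟩ := exists_quotient_cocycle N ρ₁ f hf
  obtain ⟨gb, hgb⟩ := exists_quotient_cocycle N ρ₂ g hg
  -- the pairing restricted to the invariants, as a pairing of the quotient representations
  have hmem : ∀ (w₁ : ρ₁.invariantsOf N) (w₂ : ρ₂.invariantsOf N),
      φ.toLin (w₁ : M₁) (w₂ : M₂) ∈ ρ₃.invariantsOf N := by
    intro w₁ w₂
    rw [ContinuousRep.mem_invariantsOf_iff]
    intro n
    have h := φ.toLin_smul (n : Γ) (w₁ : M₁) (w₂ : M₂)
    have h1 : ρ₁.toTopRep.ρ (n : Γ) (w₁ : M₁) = w₁ := w₁.2 n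
    have h2' : ρ₂.toTopRep.ρ (n : Γ) (w₂ : M₂) = w₂ := w₂.2 n
    rw [h1, h2'] at h
    exact h.symm
  let B : ρ₁.invariantsOf N →ₗ[ℤ] ρ₂.invariantsOf N →ₗ[ℤ] ρ₃.invariantsOf N :=
    LinearMap.mk₂ ℤ (fun w₁ w₂ => ⟨φ.toLin (w₁ : M₁) (w₂ : M₂), hmem w₁ w₂⟩)
      (fun w w' u => Subtype.ext (by simp [map_add, LinearMap.add_apply]))
      (fun c w u => Subtype.ext (by simp [LinearMap.smul_apply]))
      (fun w u u' => Subtype.ext (by simp [map_add]))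
      (fun c w u => Subtype.ext (by simp))
  have hB : ∀ (q : Γ ⧸ N) (w₁ : ρ₁.invariantsOf N) (w₂ : ρ₂.invariantsOf N),
      B ((ρ₁.quotientInvariants N).toTopRep.ρ q w₁) ((ρ₂.quotientInvariants N).toTopRep.ρ q w₂) =
        (ρ₃.quotientInvariants N).toTopRep.ρ q (B w₁ w₂) := by
    intro q w₁ w₂
    induction q using QuotientGroup.induction_on with
    | H x =>
      apply Subtype.ext
      change φ.toLin ((ρ₁.quotientInvariants N (x : Γ ⧸ N) w₁ : ρ₁.invariantsOf N) : M₁)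
          ((ρ₂.quotientInvariants N (x : Γ ⧸ N) w₂ : ρ₂.invariantsOf N) : M₂) =
        ((ρ₃.quotientInvariants N (x : Γ ⧸ N) (B w₁ w₂) : ρ₃.invariantsOf N) : M₃)
      rw [ContinuousRep.quotientInvariants_apply_coe, ContinuousRep.quotientInvariants_apply_coe,
        ContinuousRep.quotientInvariants_apply_coe]
      exact φ.toLin_smul x (w₁ : M₁) (w₂ : M₂)
  let PQ : ContPairing (ρ₁.quotientInvariants N).toTopRep (ρ₂.quotientInvariants N).toTopRep
      (ρ₃.quotientInvariants N).toTopRep := ContPairing.ofDiscrete B hB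
  have hPQ : ∀ (w₁ : ρ₁.invariantsOf N) (w₂ : ρ₂.invariantsOf N),
      ((PQ.toLin w₁ w₂ : ρ₃.invariantsOf N) : M₃) = φ.toLin (w₁ : M₁) (w₂ : M₂) := fun _ _ => rfl
  -- `H²(Γ/N, M₃^N) = 0`: the cup product of the factored cocycles is a coboundary
  have h0 : PQ.cupClass fb gb = 0 := Subsingleton.elim _ _
  unfold ContPairing.cupClass at h0
  rw [cxClass_eq_zero_iff _ 2 3 up_nat_next_two 1 up_nat_prev_two] at h0
  obtain ⟨τ, hτ⟩ := h0
  have hτpt : ∀ a b c : Γ ⧸ N,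
      τ.1 b c - (τ.1 a c - τ.1 a b) = PQ.toLin (fb.1 b - fb.1 a) (gb.1 c - gb.1 b) := by
    intro a b c
    have h := congrArg (fun s : (homogeneousCochains (ρ₃.quotientInvariants N).toTopRep).X 2 =>
      s.1 a b c) hτ
    simp only at h
    rw [ContPairing.d_one_two_apply, ContPairing.cupTwoCochain_apply] at h
    exact h
  -- pull the bounding cochain back to `Γ`
  have hHc : Continuous fun p : Γ × Γ => ((τ.1 (p.1 : Γ ⧸ N) (p.2 : Γ ⧸ N) : ρ₃.invariantsOf N) : M₃) :=
    continuous_subtype_val.comp (continuous_eval.comp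
      (((τ.1.continuous.comp (continuous_quot_mk.comp continuous_fst)).prodMk
        (continuous_quot_mk.comp continuous_snd))))
  let H : C(Γ × Γ, M₃) := ⟨fun p => ((τ.1 (p.1 : Γ ⧸ N) (p.2 : Γ ⧸ N) : ρ₃.invariantsOf N) : M₃), hHc⟩
  have hH : ∀ x y : Γ, H (x, y) = ((τ.1 (x : Γ ⧸ N) (y : Γ ⧸ N) : ρ₃.invariantsOf N) : M₃) :=
    fun _ _ => rfl
  have hHinv : ∀ (s x y : Γ), ρ₃.toTopRep.ρ s (H (s⁻¹ * x, s⁻¹ * y)) = H (x, y) := by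
    intro s x y
    have key : ((ρ₃.quotientInvariants N ((s : Γ) : Γ ⧸ N)
        (τ.1 ((s⁻¹ * x : Γ) : Γ ⧸ N) ((s⁻¹ * y : Γ) : Γ ⧸ N)) : ρ₃.invariantsOf N) : M₃) =
        ((τ.1 (x : Γ ⧸ N) (y : Γ ⧸ N) : ρ₃.invariantsOf N) : M₃) :=
      congrArg (fun w : ρ₃.invariantsOf N => (w : M₃))
        (congrArg (fun F : C(Γ ⧸ N, C(Γ ⧸ N, ρ₃.invariantsOf N)) => F (x : Γ ⧸ N) (y : Γ ⧸ N))
          (τ.2 (s : Γ ⧸ N)))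
    rw [ContinuousRep.quotientInvariants_apply_coe] at key
    rw [hH, hH]
    exact key
  unfold ContPairing.cupClass
  rw [cxClass_eq_zero_iff _ 2 3 up_nat_next_two 1 up_nat_prev_two]
  refine ⟨ContPairing.oneCochainOfFun H hHinv, Subtype.ext ?_⟩
  refine ContinuousMap.ext fun x => ContinuousMap.ext fun y => ContinuousMap.ext fun z => ?_
  rw [ContPairing.d_one_two_apply, ContPairing.oneCochainOfFun_apply,
    ContPairing.oneCochainOfFun_apply, ContPairing.oneCochainOfFun_apply,
    ContPairing.cupTwoCochain_apply, hH, hH, hH]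
  have h := congrArg (fun w : ρ₃.invariantsOf N => (w : M₃)) (hτpt (x : Γ ⧸ N) (y : Γ ⧸ N) (z : Γ ⧸ N))
  simp only [Submodule.coe_sub] at h
  rw [h, hPQ, Submodule.coe_sub, Submodule.coe_sub, hfb, hfb, hgb, hgb]

end Abstract

end UnramifiedCup

end Literature.NumberTheory.GaloisCohomology.PoitouTateFinite.GaloisImage

end Part2

/-!
## Part 3 — port of `Summits/BirchSwinnertonDyer/Rank1Residual/X11b/LocalTrivialityBridge.lean` (1 declarations kept)

# local triviality at a decomposition group `D_v ≤ Γ_K` versus in `H¹(K_v, M)`: the bridge between the `GreenbergSelmer` vocabulary and the Poitou–Tate vocabulary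

Declarations of this Part (verbatim port; each keeps its own docstring and citation): `map_oneCocycleClass_eq_zero_iff`.

Reference keys (see `references.bib` and the declarations' citations): [SerreGaloisCohomology1997].
-/

section Part3

open scoped _root_.Classical

open _root_.CategoryTheory _root_.NumberField _root_.IsDedekindDomain _root_.Field
open Literature.NumberTheory.EllipticCurves
open Literature.NumberTheory.GaloisRepresentations

universe u

namespace Literature.NumberTheory.GaloisCohomology.PoitouTateFinite.LocBridge

section TopRepLevel

variable {G L : Type u} [Group G] [TopologicalSpace G] [IsTopologicalGroup G]
  [Group L] [TopologicalSpace L] [IsTopologicalGroup L]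

/-- **`[f ∘ φ ∘ θ] = 0 ↔ φ` is principal on `range θ`.**  For a continuous homomorphism
`θ : L → G`, topological representations `X` of `G` and `Y` of `L`, and a morphism
`f : res_θ X ⟶ Y` which is BIJECTIVE on the underlying modules, the class of the pulled-back
crossed homomorphism `f ∘ φ ∘ θ` vanishes in `H¹_cont(L, Y)` iff there is `x ∈ X` with
`φ(θ l) = θ l • x − x` for all `l ∈ L`.  (`⟸` needs nothing; `⟹`: a principal cocycle
`l ↦ l • y − y` with `y = f x` is `f (θ l • x − x)`, and `f` is injective.)  "Inflation along a
surjection is injective on `H¹`" is the case `range θ = G`.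
Serre, *Galois Cohomology*, I.§2.4 and I.§5.1. [cite: SerreGaloisCohomology1997, Ch. I §2.3 (low dimensions: H¹ as classes of crossed homomorphisms)] -/
theorem map_oneCocycleClass_eq_zero_iff (X : TopRep.{u} ℤ G) (Y : TopRep.{u} ℤ L) (θ : L →ₜ* G)
    (f : TopRep.res (θ : L →* G) X ⟶ Y) (hf : Function.Bijective f.hom)
    (φ : contOneCocycles X) :
    ContinuousCohomology.map θ f 1 (oneCocycleClass X φ) = 0 ↔
      ∃ x : X, ∀ l : L, φ.1 (θ l) = X.ρ (θ l) x - x := by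
  rw [map_oneCocycleClass, oneCocycleClass_eq_zero_iff]
  constructor
  · rintro ⟨y, hy⟩
    obtain ⟨x, rfl⟩ := hf.2 y
    refine ⟨x, fun l ↦ hf.1 ?_⟩
    have h := hy l
    rw [contOneCocycles.pullback_apply] at h
    rw [h, map_sub, ← TopRep.hom_comm_apply f l x]
    rfl
  · rintro ⟨x, hx⟩
    refine ⟨f.hom x, fun l ↦ ?_⟩
    rw [contOneCocycles.pullback_apply, hx, map_sub, ← TopRep.hom_comm_apply f l x]
    rfl

end TopRepLevel

end Literature.NumberTheory.GaloisCohomology.PoitouTateFinite.LocBridge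

end Part3

/-!
## Part 4 — port of `Summits/BirchSwinnertonDyer/Rank1Residual/X11b/MaxUnramifiedRestriction.lean` (2 declarations kept)

# the unramified local condition `H¹_ur(F, W)` as "vanishing on the inertia group": `range (Γ_{F^nr} → Γ_F) = I_F` and `[φ] ∈ H¹_ur ⟺ φ` principal on `I_F`

Declarations of this Part (verbatim port; each keeps its own docstring and citation): `mem_unramifiedSubgroup_one_iff_exists`, `mem_unramifiedSubgroup_one_iff_forall_eq_zero`.

Reference keys (see `references.bib` and the declarations' citations): [MilneADT2006].
-/

section Part4

open scoped _root_.Classical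

open _root_.CategoryTheory _root_.Field ValuativeRel
open Literature.NumberTheory.GaloisRepresentations
open Literature.NumberTheory.GaloisRepresentations.IsNonarchimedeanLocalField

universe u

namespace Literature.NumberTheory.GaloisCohomology.PoitouTateFinite.LocBridge

section LocalField

variable (F : Type u) [Field F] [ValuativeRel F] [TopologicalSpace F] [IsNonarchimedeanLocalField F]

variable {F}
variable {W : Type u} [AddCommGroup W] [TopologicalSpace W] [DiscreteTopology W]
  (ρ : DiscreteGaloisModule F W)

/-- **`[φ] ∈ H¹_ur(F, W) ⟺ φ` is principal on the inertia group**: for every discrete Galois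
module `W` over the local field `F` and every continuous crossed homomorphism `φ`,
`[φ] ∈ unramifiedSubgroup ρ 1 = ker (H¹(F, W) → H¹(F^{nr}, W))` iff
`∃ w, ∀ τ ∈ I_F, φ τ = τ w − w` (the restriction is a pull-back along `Γ_{F^{nr}} → Γ_F`, whose
kernel depends only on its range `I_F`; `LocBridge.map_oneCocycleClass_eq_zero_iff`).
Milne, *ADT*, I §2 (`H¹_ur = H¹(G/I, M^I) = ker (H¹(G, M) → H¹(I, M))`).
[cite: MilneADT2006, Ch. I §2 (unramified cohomology)] -/
theorem mem_unramifiedSubgroup_one_iff_exists (φ : contOneCocycles ρ.toTopRep) :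
    oneCocycleClass ρ.toTopRep φ ∈ DiscreteGaloisModule.unramifiedSubgroup ρ 1 ↔
      ∃ w : W, ∀ τ ∈ absInertia F, φ.1 τ = ρ τ w - w := by
  refine (DiscreteGaloisModule.mem_unramifiedSubgroup_iff ρ 1 _).trans ?_
  refine (map_oneCocycleClass_eq_zero_iff ρ.toTopRep
    (DiscreteGaloisModule.toTopRep (GaloisRep.restrictField (maxUnramified F) ρ))
    (absGaloisRestrict F (maxUnramified F)) (TopRep.ofHom ⟨ContinuousLinearMap.id ℤ W, fun _ ↦ rfl⟩)
    Function.bijective_id φ).trans ?_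
  constructor
  · rintro ⟨w, hw⟩
    refine ⟨w, fun τ hτ ↦ ?_⟩
    obtain ⟨l, rfl⟩ : τ ∈ Set.range (absGaloisRestrict F (maxUnramified F)) := by
      rw [Literature.NumberTheory.GaloisRepresentations.IsNonarchimedeanLocalField.setRange_absGaloisRestrict_maxUnramified F]; exact hτ
    exact hw l
  · rintro ⟨w, hw⟩
    refine ⟨w, fun l ↦ hw _ ?_⟩
    rw [← SetLike.mem_coe, ← Literature.NumberTheory.GaloisRepresentations.IsNonarchimedeanLocalField.setRange_absGaloisRestrict_maxUnramified F]
    exact Set.mem_range_self l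

/-- **If the inertia group acts trivially on `W`, `[φ] ∈ H¹_ur(F, W) ⟺ φ` vanishes on `I_F`.**
(Then `H¹_ur(F, W) = H¹(Γ_F/I_F, W)` inflated.) Milne, *ADT*, I §2.
[cite: MilneADT2006, Ch. I §2 (unramified cohomology)] -/
theorem mem_unramifiedSubgroup_one_iff_forall_eq_zero
    (hI : ∀ τ ∈ absInertia F, ∀ w : W, ρ τ w = w) (φ : contOneCocycles ρ.toTopRep) :
    oneCocycleClass ρ.toTopRep φ ∈ DiscreteGaloisModule.unramifiedSubgroup ρ 1 ↔
      ∀ τ ∈ absInertia F, φ.1 τ = 0 := by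
  rw [mem_unramifiedSubgroup_one_iff_exists]
  constructor
  · rintro ⟨w, hw⟩ τ hτ
    rw [hw τ hτ, hI τ hτ, sub_self]
  · intro h
    exact ⟨0, fun τ hτ ↦ by rw [h τ hτ, map_zero, sub_zero]⟩

end LocalField

end Literature.NumberTheory.GaloisCohomology.PoitouTateFinite.LocBridge

end Part4

/-!
## Part 5 — port of `Summits/BirchSwinnertonDyer/Rank1Residual/GaloisImage/KolyvaginPrimeLocalShape.lean` (2 declarations kept)

# Kolyvagin-prime LOCAL SHAPE, part (U): `#H¹_ur(K_𝔮, T̄) = #T̄^{Γ_{K_𝔮}} = #T̄/(Fr_𝔮 − 1)T̄`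

Declarations of this Part (verbatim port; each keeps its own docstring and citation): `mem_unramifiedSubgroup_one_iff_resSubgroup_galUnr_eq_zero`, `natCard_unramifiedSubgroup_eq_natCard_invariants`.

Reference keys (see `references.bib` and the declarations' citations): [MilneADT2006], [Rubin2011].
-/

section Part5

open scoped _root_.Classical

universe u

namespace Literature.NumberTheory.GaloisCohomology.PoitouTateFinite.GaloisImage

open _root_.CategoryTheory ContinuousCohomology _root_.Function _root_.Field ValuativeRel _root_.NumberField _root_.IsDedekindDomain
open Literature.NumberTheory.GaloisRepresentations
open Literature.NumberTheory.GaloisRepresentations.IsNonarchimedeanLocalField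
open _root_.TopRep
open Literature.NumberTheory.GaloisCohomology
open scoped _root_.NumberField

section Unramified

variable {F : Type u} [Field F] [ValuativeRel F] [TopologicalSpace F] [IsNonarchimedeanLocalField F]
variable {W : Type u} [AddCommGroup W] [TopologicalSpace W] [DiscreteTopology W] [Finite W]
  (ρ : DiscreteGaloisModule F W)

omit [Finite W] in
/-- **`[φ] ∈ H¹_ur(F, W)` iff the restriction of `[φ]` to the inertia group `Gal(F̄/F^{nr})`
vanishes**, for `W` with trivial inertia action (both say: `φ` vanishes on `I_F`).
[cite: MilneADT2006, Ch. I §2 (unramified cohomology)] -/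
theorem mem_unramifiedSubgroup_one_iff_resSubgroup_galUnr_eq_zero
    (hI : ∀ τ ∈ absInertia F, ∀ w : W, ρ τ w = w) (φ : contOneCocycles ρ.toTopRep) :
    oneCocycleClass ρ.toTopRep φ ∈ DiscreteGaloisModule.unramifiedSubgroup ρ 1 ↔
      resSubgroup ρ.toTopRep (galUnr F) 1 (oneCocycleClass ρ.toTopRep φ) = 0 := by
  rw [LocBridge.mem_unramifiedSubgroup_one_iff_forall_eq_zero ρ hI φ,
    resSubgroup_oneCocycleClass, oneCocycleClass_eq_zero_iff]
  constructor
  · intro h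
    refine ⟨0, fun n => ?_⟩
    rw [contOneCocycles.pullback_apply, map_zero, sub_zero]
    exact h n (by rw [← galUnr_eq_absInertia F]; exact n.2)
  · rintro ⟨w, hw⟩ τ hτ
    have hτ' : τ ∈ galUnr F := by rw [galUnr_eq_absInertia F]; exact hτ
    have h := hw ⟨τ, hτ'⟩
    rw [contOneCocycles.pullback_apply] at h
    -- the inertia group acts trivially: the coboundary vanishes
    have htriv : (subgroupRep ρ.toTopRep (galUnr F)).ρ ⟨τ, hτ'⟩ w = w := hI τ hτ w
    rw [htriv, sub_self] at h
    exact h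

/-- **`#H¹_ur(F, W) = #W^{Γ_F}` for a finite unramified `W`** (Rubin PCMI Prop. 1.4.13 (1),
`H¹_u(K, A) = H¹(K^{ur}/K, A) ≅ A/(ϕ − 1)A`, as a count; Milne *ADT* I Lemma 2.9): `H¹_ur` is the
image of the injective inflation from `Γ_F/I_F` (inflation–restriction) and `h¹ = h⁰` for finite
modules over `Γ_F/I_F ≅ Ẑ`. [cite: Rubin2011, Prop. 1.4.13 (1) (p. 9)] [cite: MilneADT2006, Ch. I, Lemma 2.9] -/
theorem natCard_unramifiedSubgroup_eq_natCard_invariants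
    (hI : ∀ τ ∈ absInertia F, ∀ w : W, ρ τ w = w) :
    Nat.card (DiscreteGaloisModule.unramifiedSubgroup ρ 1) = Nat.card ρ.toTopRep.ρ.invariants := by
  haveI := absoluteGaloisGroup_compactSpace F
  set N : Subgroup (absoluteGaloisGroup F) := galUnr F
  have hex := infOne_exact_resSubgroup N ρ
  -- every unramified class is inflated, and conversely
  have hmem : ∀ c : galoisCohomology ρ 1,
      c ∈ DiscreteGaloisModule.unramifiedSubgroup ρ 1 ↔ c ∈ Set.range (infOne N ρ) := by
    intro c
    obtain ⟨φ, rfl⟩ := oneCocycleClass_surjective ρ.toTopRep c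
    exact (mem_unramifiedSubgroup_one_iff_resSubgroup_galUnr_eq_zero ρ hI φ).trans (hex _)
  have e : continuousCohomology 1 (ρ.quotientInvariants N).toTopRep ≃
      DiscreteGaloisModule.unramifiedSubgroup ρ 1 :=
    Equiv.ofBijective (fun x => ⟨infOne N ρ x, (hmem _).mpr ⟨x, rfl⟩⟩)
      ⟨fun x y hxy => infOne_injective N ρ (congrArg Subtype.val hxy),
        fun c => by
          obtain ⟨x, hx⟩ := (hmem c.1).mp c.2
          exact ⟨x, Subtype.ext hx⟩⟩
  rw [← Nat.card_congr e, natCard_continuousCohomology_one_quotient_galUnr F _ (ρ.quotientInvariants N)]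
  exact Nat.card_congr (invariantsQuotientInvariantsEquiv N ρ)

end Unramified

end Literature.NumberTheory.GaloisCohomology.PoitouTateFinite.GaloisImage

end Part5

/-!
## Part 6 — port of `Summits/BirchSwinnertonDyer/Rank1Residual/GaloisImage/TransverseOrthogonal.lean` (2 declarations kept)

# `TransverseOrthogonal` (Mazur–Rubin Prop. 1.3.2 (ii), both clauses) PROVED for every PERFECT family of local invariant maps at ODD `n`

Declarations of this Part (verbatim port; each keeps its own docstring and citation): `nsmul_tateDual_apply`, `nsmul_tateDual_eq_zero`.

Reference keys (see `references.bib` and the declarations' citations): [MilneADT2006].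
-/

section Part6

open _root_.CategoryTheory _root_.Function
open scoped ContRepresentation

universe u

namespace Literature.NumberTheory.GaloisCohomology.PoitouTateFinite.GaloisImage

namespace TransverseCup

open _root_.Field ValuativeRel _root_.NumberField _root_.IsDedekindDomain
open Literature.NumberTheory.GaloisRepresentations
open Literature.NumberTheory.GaloisRepresentations.IsNonarchimedeanLocalField
open _root_.TopRep _root_.ContRepresentation _root_.ContinuousCohomology
open Literature.NumberTheory.GaloisCohomology
open scoped _root_.NumberField

variable {K : Type u} [Field K] [NumberField K]

section Inertia

variable {M : Type u} [AddCommGroup M] [TopologicalSpace M] [DiscreteTopology M] [Finite M]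
  (ρ : DiscreteGaloisModule K M) (n : ℕ) (v : HeightOneSpectrum (𝓞 K))

omit [NumberField K] [TopologicalSpace M] [DiscreteTopology M] [Finite M] in
/-- `(c·f)(m) = c·f(m)` on the Tate dual. [cite: MilneADT2006, Ch. I §2 (the dual module M^D = Hom(M, μ_n))] -/
theorem nsmul_tateDual_apply (c : ℕ) (f : DiscreteGaloisModule.TateDual K M n) (m : M) :
    (c • f) m = c • f m := by
  induction c with
  | zero => rw [zero_nsmul, zero_nsmul, DiscreteGaloisModule.TateDual.zero_apply]
  | succ c ih => rw [succ_nsmul, succ_nsmul, DiscreteGaloisModule.TateDual.add_apply, ih]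

omit [NumberField K] [TopologicalSpace M] [DiscreteTopology M] [Finite M] in
/-- An integer killing `M` kills `M^D = Hom(M, μₙ)` ("`|F^×|·T = 0` ⟹ `|F^×|·T^* = 0`"). [cite: MilneADT2006, Ch. I §2 (the dual module M^D = Hom(M, μ_n))] -/
theorem nsmul_tateDual_eq_zero {c : ℕ} (hM : ∀ m : M, c • m = 0)
    (f : DiscreteGaloisModule.TateDual K M n) : c • f = 0 := by
  refine DiscreteGaloisModule.TateDual.ext fun m => ?_
  rw [nsmul_tateDual_apply, ← map_nsmul, hM, map_zero, DiscreteGaloisModule.TateDual.zero_apply]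

end Inertia

end TransverseCup

end Literature.NumberTheory.GaloisCohomology.PoitouTateFinite.GaloisImage

end Part6

/-!
## Part 7 — port of `Summits/BirchSwinnertonDyer/Rank1Residual/GaloisImage/UnramifiedLocalPairingVanishing.lean` (2 declarations kept)

# Unramified classes cup to ZERO: the orthogonality half of Milne I Thm. 2.6 as a KERNEL theorem for EVERY family of local invariant maps

Declarations of this Part (verbatim port; each keeps its own docstring and citation): `localTatePairing_eq_zero_of_mem_unramifiedSubgroup`, `localTatePairingZMod_eq_zero_of_mem_unramifiedSubgroup`.

Reference keys (see `references.bib` and the declarations' citations): [MilneADT2006].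
-/

section Part7

open _root_.CategoryTheory _root_.Function
open scoped ContRepresentation

universe u

namespace Literature.NumberTheory.GaloisCohomology.PoitouTateFinite.GaloisImage

namespace UnramifiedCup

open _root_.Field ValuativeRel _root_.NumberField _root_.IsDedekindDomain
open Literature.NumberTheory.GaloisRepresentations
open Literature.NumberTheory.GaloisRepresentations.IsNonarchimedeanLocalField
open _root_.TopRep _root_.ContRepresentation _root_.ContinuousCohomology
open Literature.NumberTheory.GaloisCohomology
open scoped _root_.NumberField

variable {K : Type u} [Field K] [NumberField K] {M : Type u} [AddCommGroup M] [TopologicalSpace M]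
  [DiscreteTopology M] [Finite M] (ρ : DiscreteGaloisModule K M) (n : ℕ) [NeZero n]
  (v : HeightOneSpectrum (𝓞 K))

/-- **Unramified classes cup to zero** (orthogonality half of Milne I Thm. 2.6, for the cup product
itself): for a finite discrete `Γ_K`-module `M`, `n ≠ 0`, a finite place `v` such that the inertia
group of `K_v` acts trivially on `M|_v` AND on `M^D|_v`, and `a ∈ H¹_ur(K_v, M)`, `b ∈ H¹_ur(K_v, M^D)`:
`a ∪ b = 0` in `H²(K_v, μₙ)`.  Representatives vanish on `I = galUnr K_v`
(`LocBridge.mem_unramifiedSubgroup_one_iff_forall_eq_zero`), `H²(Γ_{K_v}/I, μₙ^I) = 0`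
(`subsingleton_two_quotient_galUnr_of_finite`), and
`UnramifiedCup.cupClass_eq_zero_of_vanishing_of_subsingleton`. [cite: MilneADT2006, Ch. I, Thm. 2.6] -/
theorem localTatePairing_eq_zero_of_mem_unramifiedSubgroup
    (hI : ∀ t ∈ absInertia (v.adicCompletion K), ∀ m : M, GaloisRep.toLocal v ρ t m = m)
    (hID : ∀ t ∈ absInertia (v.adicCompletion K), ∀ f : DiscreteGaloisModule.TateDual K M n,
      GaloisRep.toLocal v (ρ.tateDual n) t f = f)
    {a : galoisCohomology (GaloisRep.toLocal v ρ) 1}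
    (ha : a ∈ DiscreteGaloisModule.unramifiedSubgroup (GaloisRep.toLocal v ρ) 1)
    {b : galoisCohomology (GaloisRep.toLocal v (ρ.tateDual n)) 1}
    (hb : b ∈ DiscreteGaloisModule.unramifiedSubgroup (GaloisRep.toLocal v (ρ.tateDual n)) 1) :
    DiscreteGaloisModule.localTatePairing ρ n (Sum.inr v) a b = 0 := by
  classical
  haveI := absoluteGaloisGroup_compactSpace (v.adicCompletion K)
  obtain ⟨f, rfl⟩ := oneCocycleClass_surjective _ a
  obtain ⟨g, rfl⟩ := oneCocycleClass_surjective _ b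
  have hf := (LocBridge.mem_unramifiedSubgroup_one_iff_forall_eq_zero (GaloisRep.toLocal v ρ) hI f).1 ha
  have hg := (LocBridge.mem_unramifiedSubgroup_one_iff_forall_eq_zero
    (GaloisRep.toLocal v (ρ.tateDual n)) hID g).1 hb
  -- `H²(Γ/I, μₙ^I) = 0` (`cd(Ẑ) = 1`)
  haveI : Finite (DiscreteGaloisModule.MuCarrier K n) := finite_muCarrier (F := K) n
  haveI : Subsingleton (continuousCohomology 2
      ((GaloisRep.toLocal v (DiscreteGaloisModule.mu K n)).quotientInvariants
        (galUnr (v.adicCompletion K))).toTopRep) :=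
    subsingleton_two_quotient_galUnr_of_finite (v.adicCompletion K) _ _
  change ContPairing.cupProduct (DiscreteGaloisModule.pairing (GaloisRep.toLocal v ρ)
      (GaloisRep.toLocal v (ρ.tateDual n)) (GaloisRep.toLocal v (DiscreteGaloisModule.mu K n))
      (DiscreteGaloisModule.tateDualEval K M n)
      (fun _ m f => DiscreteGaloisModule.tateDualEval_smul ρ n _ m f))
      (oneCocycleClass _ f) (oneCocycleClass _ g) = 0
  rw [ContPairing.cupProduct_oneCocycleClass]
  refine cupClass_eq_zero_of_vanishing_of_subsingleton (galUnr (v.adicCompletion K)) _ _ _ _ f g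
    (fun t ht => hf t ?_) (fun t ht => hg t ?_)
  · rw [← galUnr_eq_absInertia]; exact ht
  · rw [← galUnr_eq_absInertia]; exact ht

/-- **`⟨a, b⟩_v = inv_v(a ∪ b) = 0` for unramified `a`, `b`, for EVERY additive `inv_v`**
(no property of `inv_v` is used). [cite: MilneADT2006, Ch. I, Thm. 2.6] -/
theorem localTatePairingZMod_eq_zero_of_mem_unramifiedSubgroup
    (hI : ∀ t ∈ absInertia (v.adicCompletion K), ∀ m : M, GaloisRep.toLocal v ρ t m = m)
    (hID : ∀ t ∈ absInertia (v.adicCompletion K), ∀ f : DiscreteGaloisModule.TateDual K M n,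
      GaloisRep.toLocal v (ρ.tateDual n) t f = f)
    (inv : galoisCohomology ((DiscreteGaloisModule.mu K n).toLocal (Sum.inr v)) 2 →+ ZMod n)
    {a : galoisCohomology (GaloisRep.toLocal v ρ) 1}
    (ha : a ∈ DiscreteGaloisModule.unramifiedSubgroup (GaloisRep.toLocal v ρ) 1)
    {b : galoisCohomology (GaloisRep.toLocal v (ρ.tateDual n)) 1}
    (hb : b ∈ DiscreteGaloisModule.unramifiedSubgroup (GaloisRep.toLocal v (ρ.tateDual n)) 1) :
    DiscreteGaloisModule.localTatePairingZMod ρ n (Sum.inr v) inv a b = 0 := by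
  rw [DiscreteGaloisModule.localTatePairingZMod_apply,
    localTatePairing_eq_zero_of_mem_unramifiedSubgroup ρ n v hI hID ha hb, map_zero]

end UnramifiedCup

end Literature.NumberTheory.GaloisCohomology.PoitouTateFinite.GaloisImage

end Part7

/-!
## Part 8 — port of `Summits/BirchSwinnertonDyer/Rank1Residual/GaloisImage/UnramifiedOrthogonalOfIsPerfect.lean` (5 declarations kept)

# Milne I Thm. 2.6 (`UnramifiedOrthogonal`) PROVED for every PERFECT family of local invariant maps at prime-power `n` — the third conjunct of the Poitou–Tate fact is a theorem of the first

Declarations of this Part (verbatim port; each keeps its own docstring and citation): `isUnit_natCast_integer_of_not_mem`, `ringChar_residueField_not_dvd_of_not_mem`, `toLocal_mu_apply_of_mem_absInertia_of_not_mem`, `toLocal_tateDual_apply_of_mem_absInertia_of_not_mem`, `unramifiedSubgroup_tateDual_le_dualLocalCondition'`.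

Reference keys (see `references.bib` and the declarations' citations): [SerreLocalFields1979].
-/

section Part8

open _root_.CategoryTheory _root_.Function
open scoped ContRepresentation

universe u

namespace Literature.NumberTheory.GaloisCohomology.PoitouTateFinite.GaloisImage

namespace UnramifiedCup

open _root_.Field ValuativeRel _root_.NumberField _root_.IsDedekindDomain
open Literature.NumberTheory.GaloisRepresentations
open Literature.NumberTheory.GaloisRepresentations.IsNonarchimedeanLocalField
open _root_.TopRep _root_.ContRepresentation _root_.ContinuousCohomology
open Literature.NumberTheory.GaloisCohomology
open scoped _root_.NumberField

variable {K : Type u} [Field K] [NumberField K]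

section LocalInputs

variable {M : Type u} [AddCommGroup M] [TopologicalSpace M] [DiscreteTopology M] [Finite M]
  (ρ : DiscreteGaloisModule K M) (n : ℕ) (v : HeightOneSpectrum (𝓞 K))

omit [Finite M] in
/-- **`n` is a unit of `𝒪[K_v]` for `v ∤ n`**: `‖n‖_v < 1 ↔ n ∈ v` (`norm_algebraMap_ringOfIntegers_lt_one_iff`,
`adicCompletion_valuation_lt_one_iff`) and a non-unit of the valuation ring has valuation `< 1`
(`Valuation.Integer.not_isUnit_iff_valuation_lt_one`). [cite: SerreLocalFields1979, Ch. IV §4 Cor. 2 to Prop. 16] -/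
theorem isUnit_natCast_integer_of_not_mem (hv : ((n : ℕ) : 𝓞 K) ∉ v.asIdeal) :
    IsUnit ((n : ℕ) : 𝒪[v.adicCompletion K]) := by
  by_contra h
  have hlt : valuation (v.adicCompletion K) (((n : ℕ) : 𝒪[v.adicCompletion K]) : v.adicCompletion K) < 1 :=
    (Valuation.Integer.not_isUnit_iff_valuation_lt_one (x := ((n : ℕ) : 𝒪[v.adicCompletion K]))).1 h
  have hnorm : ‖((n : ℕ) : v.adicCompletion K)‖ < 1 := by
    have := (adicCompletion_valuation_lt_one_iff K v _).1 hlt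
    simpa using this
  apply hv
  rw [← norm_algebraMap_ringOfIntegers_lt_one_iff K v]
  simpa using hnorm

/-- The residue characteristic of `K_v` does not divide `n` when `v ∤ n` (else `n ∈ 𝓂[K_v]`). [cite: SerreLocalFields1979, Ch. IV §4 Cor. 2 to Prop. 16] -/
theorem ringChar_residueField_not_dvd_of_not_mem (hv : ((n : ℕ) : 𝓞 K) ∉ v.asIdeal) :
    ¬ ringChar 𝓀[v.adicCompletion K] ∣ n := by
  intro hdvd
  have hunit := isUnit_natCast_integer_of_not_mem n v hv
  -- `char 𝓀 ∣ n` forces the residue of `n` to vanish, so `n ∈ 𝓂`, not a unit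
  have h0 : IsLocalRing.residue 𝒪[v.adicCompletion K] ((n : ℕ) : 𝒪[v.adicCompletion K]) = 0 := by
    rw [map_natCast, ringChar.spec]
    exact hdvd
  rw [IsLocalRing.residue_eq_zero_iff] at h0
  exact (IsLocalRing.mem_maximalIdeal _).1 h0 hunit

/-- **The inertia group of `K_v` fixes `μₙ(K̄)` for every `v ∤ n`** (no primality of `N(v)`): Serre,
*Local Fields* IV §4 Cor. 2 to Prop. 16 (`mem_absInertia_iff_smul_rootsOfUnity`) transported along
the chosen embedding `K̄ → K̄_v` (`absGaloisRestrict_apply_smul`); generalises T-M2p-K's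
`TransverseCup.toLocal_mu_apply_of_mem_absInertia`. [cite: SerreLocalFields1979, Ch. IV §4 Cor. 2 to Prop. 16] -/
theorem toLocal_mu_apply_of_mem_absInertia_of_not_mem (hv : ((n : ℕ) : 𝓞 K) ∉ v.asIdeal)
    {t : absoluteGaloisGroup (v.adicCompletion K)} (ht : t ∈ absInertia (v.adicCompletion K))
    (ζ : DiscreteGaloisModule.MuCarrier K n) :
    GaloisRep.toLocal v (DiscreteGaloisModule.mu K n) t ζ = ζ := by
  have hunit := isUnit_natCast_integer_of_not_mem n v hv
  set u : (AlgebraicClosure K)ˣ :=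
    (((DiscreteGaloisModule.MuCarrier.toAdditive ζ).toMul : rootsOfUnity n (AlgebraicClosure K)) :
      (AlgebraicClosure K)ˣ) with hu
  have hun : (u : AlgebraicClosure K) ^ n = 1 := by
    have h := ((DiscreteGaloisModule.MuCarrier.toAdditive ζ).toMul).2
    rw [mem_rootsOfUnity] at h
    rw [← Units.val_pow_eq_pow_val, hu, h, Units.val_one]
  have hfixL : t • absClosureEmbedding K (v.adicCompletion K) (u : AlgebraicClosure K) =
      absClosureEmbedding K (v.adicCompletion K) (u : AlgebraicClosure K) :=
    (mem_absInertia_iff_smul_rootsOfUnity.1 ht) n hunit _ (by rw [← map_pow, hun, map_one])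
  have hfix : absGaloisRestrict K (v.adicCompletion K) t • (u : AlgebraicClosure K) = u := by
    apply (absClosureEmbedding K (v.adicCompletion K)).toRingHom.injective
    exact (absGaloisRestrict_apply_smul K (v.adicCompletion K) t _).trans hfixL
  change Additive.ofMul (absGaloisRestrict K (v.adicCompletion K) t • Additive.toMul ζ) =
    Additive.ofMul (Additive.toMul ζ)
  refine congrArg Additive.ofMul (Subtype.ext (Units.ext ?_))
  rw [absoluteGaloisGroup.coe_smul_rootsOfUnity, Units.coe_smul]
  exact hfix

/-- **`M^D = Hom(M, μₙ)` is unramified at every `v ∤ n` where `M` is** (general version of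
`TransverseCup.toLocal_tateDual_apply_of_mem_absInertia`). [cite: SerreLocalFields1979, Ch. IV §4 Cor. 2 to Prop. 16] -/
theorem toLocal_tateDual_apply_of_mem_absInertia_of_not_mem (hv : ((n : ℕ) : 𝓞 K) ∉ v.asIdeal)
    (hur : GaloisRep.IsUnramifiedAt v ρ)
    {t : absoluteGaloisGroup (v.adicCompletion K)} (ht : t ∈ absInertia (v.adicCompletion K))
    (f : DiscreteGaloisModule.TateDual K M n) : GaloisRep.toLocal v (ρ.tateDual n) t f = f := by
  refine DiscreteGaloisModule.TateDual.ext fun m => ?_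
  change ρ.tateDual n (absGaloisRestrict K (v.adicCompletion K) t) f m = f m
  rw [DiscreteGaloisModule.tateDual_apply_apply_apply]
  have h1 : ρ (absGaloisRestrict K (v.adicCompletion K) t)⁻¹ m = m := by
    have h := (GaloisRep.isUnramifiedAt_iff_toLocal_holds v ρ).1 hur t⁻¹ ((absInertia _).inv_mem ht)
    rw [← map_inv]
    change GaloisRep.toLocal v ρ t⁻¹ m = m
    rw [h]
    rfl
  rw [h1]
  exact toLocal_mu_apply_of_mem_absInertia_of_not_mem n v hv ht (f m)

/-- **`H¹_ur(K_v, M^D) ≤ (H¹_ur(K_v, M))^*` for EVERY family `inv` at every finite `v ∤ n` where `M` is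
unramified** — the inclusion half of clause 1 of `UnramifiedOrthogonal` in exactly the predicate's
binders (no primality of `N(v)`; `UnramifiedLocalPairingVanishing.unramifiedSubgroup_tateDual_le_dualLocalCondition`
assumed `N(v)` prime only to read the residue characteristic). [cite: MilneADT2006, Ch. I, Thm. 2.6] -/
theorem unramifiedSubgroup_tateDual_le_dualLocalCondition' [NeZero n] (inv : LocalInvariants K n)
    (hv : ((n : ℕ) : 𝓞 K) ∉ v.asIdeal) (hur : GaloisRep.IsUnramifiedAt v ρ) :
    DiscreteGaloisModule.unramifiedSubgroup (GaloisRep.toLocal v (ρ.tateDual n)) 1 ≤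
      inv.dualLocalCondition ρ (Sum.inr v)
        (DiscreteGaloisModule.unramifiedSubgroup (GaloisRep.toLocal v ρ) 1) := by
  have hI : ∀ t ∈ absInertia (v.adicCompletion K), ∀ m : M, GaloisRep.toLocal v ρ t m = m := by
    intro t ht m
    have h := (GaloisRep.isUnramifiedAt_iff_toLocal_holds v ρ).1 hur t ht
    rw [h]
    rfl
  have hID : ∀ t ∈ absInertia (v.adicCompletion K), ∀ f : DiscreteGaloisModule.TateDual K M n,
      GaloisRep.toLocal v (ρ.tateDual n) t f = f :=
    fun t ht f => toLocal_tateDual_apply_of_mem_absInertia_of_not_mem ρ n v hv hur ht f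
  intro b hb a ha
  exact localTatePairingZMod_eq_zero_of_mem_unramifiedSubgroup ρ n v hI hID _ ha hb

end LocalInputs

end UnramifiedCup

end Literature.NumberTheory.GaloisCohomology.PoitouTateFinite.GaloisImage

end Part8

/-!
## Part 9 — port of `Summits/BirchSwinnertonDyer/Rank1Residual/X11b/WeilTransport.lean` (2 declarations kept)

# the WEIL TRANSPORT `E[n]^D = Hom(E[n], μₙ) ≅ E[n]` on `H¹`, globally and at the completions, and the local Tate pairing of `E[n]` as a Weil cup product

Declarations of this Part (verbatim port; each keeps its own docstring and citation): `map_map_eq_self_of_comp_eq`, `map_mem_unramifiedSubgroup`.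

Reference keys (see `references.bib` and the declarations' citations): [MilneADT2006].
-/

section Part9

open scoped _root_.Classical

open _root_.CategoryTheory _root_.Field _root_.NumberField _root_.IsDedekindDomain
open Literature.NumberTheory.EllipticCurves
open Literature.NumberTheory.GaloisRepresentations
open Literature.NumberTheory.GaloisRepresentations.DiscreteGaloisModule (mu MuCarrier pairing TateDual
  tateDual tateDualPairing tateDualPairingLocal localTatePairing localTatePairingZMod unramifiedSubgroup)
open Literature.NumberTheory.GaloisCohomology
open scoped ContRepresentation

universe u

namespace Literature.NumberTheory.GaloisCohomology.PoitouTateFinite.Levels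

section Generic

variable {F : Type u} [Field F] {M₁ M₂ : Type u}
  [AddCommGroup M₁] [TopologicalSpace M₁] [DiscreteTopology M₁]
  [AddCommGroup M₂] [TopologicalSpace M₂] [DiscreteTopology M₂]
  {ρ₁ : DiscreteGaloisModule F M₁} {ρ₂ : DiscreteGaloisModule F M₂}

/-- **`H¹(g) (H¹(f) x) = x` when `g ∘ f = id` pointwise.** Serre, *Galois Cohomology*, I.§2.2.
[cite: MilneADT2006, Ch. I §2, before Thm. 2.6] -/
theorem map_map_eq_self_of_comp_eq (f : ρ₁.toContRepresentation →ⁱL ρ₂.toContRepresentation)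
    (g : ρ₂.toContRepresentation →ⁱL ρ₁.toContRepresentation) (hcomp : ∀ a : M₁, g (f a) = a)
    (x : galoisCohomology ρ₁ 1) :
    galoisCohomology.map g 1 (galoisCohomology.map f 1 x) = x := by
  obtain ⟨φ, rfl⟩ := oneCocycleClass_surjective _ x
  rw [galoisCohomology.map_one_oneCocycleClass, galoisCohomology.map_one_oneCocycleClass]
  exact congrArg (oneCocycleClass _) (Subtype.ext (ContinuousMap.ext fun σ ↦ hcomp (φ.1 σ)))

end Generic

section Unramified

variable {F : Type u} [Field F] [ValuativeRel F]
  {M₁ M₂ : Type u} [AddCommGroup M₁] [TopologicalSpace M₁] [DiscreteTopology M₁]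
  [AddCommGroup M₂] [TopologicalSpace M₂] [DiscreteTopology M₂]
  {ρ₁ : DiscreteGaloisModule F M₁} {ρ₂ : DiscreteGaloisModule F M₂}

/-- **Intertwining maps preserve unramified classes**: `H¹(f)` maps `H¹_ur(F, M₁)` into
`H¹_ur(F, M₂)` over a non-archimedean local field `F` (restriction to `F^{nr}` commutes with the
change of coefficients, `galoisCohomology.res_map_one`). [cite: MilneADT2006, Ch. I §2, before Thm. 2.6] -/
theorem map_mem_unramifiedSubgroup (f : ρ₁.toContRepresentation →ⁱL ρ₂.toContRepresentation)
    {c : galoisCohomology ρ₁ 1} (hc : c ∈ unramifiedSubgroup ρ₁ 1) :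
    galoisCohomology.map f 1 c ∈ unramifiedSubgroup ρ₂ 1 := by
  rw [DiscreteGaloisModule.mem_unramifiedSubgroup_iff] at hc ⊢
  rw [galoisCohomology.res_map_one, hc, map_zero]

end Unramified

end Literature.NumberTheory.GaloisCohomology.PoitouTateFinite.Levels

end Part9

/-!
## Part 10 — port of `Summits/BirchSwinnertonDyer/BirchSwinnertonDyer/Theorems/SchneiderFreeAdditiveX3PoitouTateBidualTransport.lean` (5 declarations kept)

# Poitou–Tate toolkit (4/4): the dual middle exactness is the middle exactness for `M^D` (biduality `M ≅ M^{DD}` and graded commutativity of the cup product) — so `SelmerComplement` ⟸ Milne I Thm. 4.10(b) `Ker γ¹ ⊆ Im β¹` ALONE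

Declarations of this Part (verbatim port; each keeps its own docstring and citation): `exists_bidual_intertwining`, `localTatePairing_tateDual_map_bidual`, `localTatePairingZMod_tateDual_map_bidual`, `isUnramifiedAt_tateDual`, `middleExact_dual_of_middleExact`.

Reference keys (see `references.bib` and the declarations' citations): [MilneADT2006], [NeukirchSchmidtWingberg2008], [Howard2004HeegnerKolyvagin].
-/

section Part10

open _root_.Function _root_.NumberField _root_.IsDedekindDomain _root_.CategoryTheory
open scoped _root_.NumberField ContRepresentation

universe u

namespace Literature.NumberTheory.GaloisCohomology.PoitouTateFinite.PoitouTateReduction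

open _root_.Field
open Literature.NumberTheory.GaloisRepresentations Literature.NumberTheory.GaloisCohomology
open Literature.NumberTheory.GaloisRepresentations.DiscreteGaloisModule (mu MuCarrier TateDual tateDual
  tateDualEval tateDualPairingLocal localTatePairing localTatePairingZMod unramifiedSubgroup SelmerStructure)

section Bidual

variable {K : Type u} [Field K] [CharZero K] {n : ℕ} [NeZero n]
variable {M : Type u} [AddCommGroup M] [TopologicalSpace M] [DiscreteTopology M] [Finite M]

/-- **Biduality `M ⥲ M^{DD} = Hom(Hom(M, μₙ), μₙ)`, `m ↦ (f ↦ f m)`, as a pair of inverse continuous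
`Γ_K`-intertwining maps** of discrete Galois modules, for a finite `M` killed by `n` (characters into
`μₙ ≅ ℤ/n` separate points, `#Hom(M, μₙ) = #M`; Milne *ADT* I Prop. 0.19 / §2 "`M^{DD} = M`").
[cite: MilneADT2006, Ch. I §0, Prop. 0.19] -/
theorem exists_bidual_intertwining [Finite (TateDual K M n)] (ρ : DiscreteGaloisModule K M)
    (hM : ∀ m : M, n • m = 0) :
    ∃ (ι : ρ.toContRepresentation →ⁱL ((ρ.tateDual n).tateDual n).toContRepresentation)
      (κ : ((ρ.tateDual n).tateDual n).toContRepresentation →ⁱL ρ.toContRepresentation),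
      (∀ (m : M) (f : TateDual K M n), ι m f = f m) ∧ (∀ m : M, κ (ι m) = m) ∧
        ∀ φ : TateDual K (TateDual K M n) n, ι (κ φ) = φ := by
  -- the evaluation map and its equivariance
  let ev : M →+ TateDual K (TateDual K M n) n := tateDualEval K M n
  have hev : ∀ (m : M) (f : TateDual K M n), ev m f = f m := fun m f => rfl
  have hsmul : ∀ (σ : absoluteGaloisGroup K) (m : M),
      ev (ρ σ m) = (ρ.tateDual n).tateDual n σ (ev m) := fun σ m => by
    refine DiscreteGaloisModule.TateDual.ext fun f => ?_
    rw [hev, DiscreteGaloisModule.tateDual_apply_apply_apply, hev,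
      DiscreteGaloisModule.tateDual_apply_apply_apply, inv_inv, ← Module.End.mul_apply, ← map_mul,
      mul_inv_cancel, map_one, Module.End.one_apply]
  -- bijectivity: injective (characters separate points) and `#M^{DD} = #M^D = #M`
  have hinj : Injective ev := tateDualEval_injective n hM
  have hD : ∀ f : TateDual K M n, n • f = 0 := fun f => DiscreteGaloisModule.TateDual.nsmul_eq_zero f
  have hc1 : Nat.card (TateDual K M n) = Nat.card M := HomCarrier.natCard_eq (muEquivZMod K n) hM
  have hc2 : Nat.card (TateDual K (TateDual K M n) n) = Nat.card (TateDual K M n) :=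
    HomCarrier.natCard_eq (muEquivZMod K n) hD
  haveI : Finite (TateDual K (TateDual K M n) n) := DiscreteGaloisModule.TateDual.finite K (TateDual K M n) n
  have hbij : Bijective ev := hinj.bijective_of_nat_card_le (by rw [hc2, hc1])
  let e : M ≃+ TateDual K (TateDual K M n) n := AddEquiv.ofBijective ev hbij
  refine ⟨{ toContinuousLinearMap := ⟨ev.toIntLinearMap, continuous_of_discreteTopology⟩
            isIntertwining' := fun σ => ContinuousLinearMap.ext fun m => hsmul σ m },
          { toContinuousLinearMap := ⟨e.symm.toAddMonoidHom.toIntLinearMap, continuous_of_discreteTopology⟩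
            isIntertwining' := fun σ => ContinuousLinearMap.ext fun φ => ?_ },
          fun m f => rfl, fun m => e.symm_apply_apply m, fun φ => e.apply_symm_apply φ⟩
  change e.symm (((ρ.tateDual n).tateDual n).toContRepresentation σ φ) =
    ρ.toContRepresentation σ (e.symm φ)
  apply e.injective
  rw [AddEquiv.apply_symm_apply, ContinuousRep.toContRepresentation_apply_apply,
    ContinuousRep.toContRepresentation_apply_apply, AddEquiv.ofBijective_apply, hsmul,
    ← AddEquiv.ofBijective_apply ev hbij, AddEquiv.apply_symm_apply]

end Bidual

section LocalSign

variable {K : Type u} [Field K] [NumberField K] {n : ℕ} [NeZero n]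
variable {M : Type u} [AddCommGroup M] [TopologicalSpace M] [DiscreteTopology M] [Finite M]

omit [NeZero n] in
/-- **`u ∪' H¹(ι_v) x = -(x ∪ u)` in `H²(K_v, μₙ)`** for local classes `x ∈ H¹(K_v, M)`,
`u ∈ H¹(K_v, M^D)`: the local Tate pairing of `M^D` (cup product for `M^D × M^{DD} → μₙ`) evaluated on the
biduality transport of `x` is minus the local Tate pairing of `M` — naturality of the cup product in the
coefficient pairing (`ContPairing.cupProduct_map`, `⟨f, ι m⟩' = f m = ⟨m, f⟩`) and graded commutativity in
bidegree `(1, 1)` (`ContPairing.cupProduct_comm`, NSW (1.4.4)).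
[cite: NeukirchSchmidtWingberg2008, I §4 (1.4.4)] [cite: MilneADT2006, Ch. I, Cor. 2.3] -/
theorem localTatePairing_tateDual_map_bidual [Finite (TateDual K M n)] (ρ : DiscreteGaloisModule K M)
    (ι : ρ.toContRepresentation →ⁱL ((ρ.tateDual n).tateDual n).toContRepresentation)
    (hι : ∀ (m : M) (f : TateDual K M n), ι m f = f m) (v : Place K)
    (x : galoisCohomology (ρ.toLocal v) 1) (u : galoisCohomology ((ρ.tateDual n).toLocal v) 1) :
    localTatePairing (ρ.tateDual n) n v u
        (galoisCohomology.map (ι.restrictField (Place.Completion v)) 1 x) =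
      -localTatePairing ρ n v x u := by
  haveI := absoluteGaloisGroup_compactSpace (Place.Completion (K := K) v)
  have h := ContPairing.cupProduct_map (tateDualPairingLocal ρ n v).flip
    (tateDualPairingLocal (ρ.tateDual n) n v) (𝟙 _)
    (DiscreteGaloisModule.homOfIntertwining (ι.restrictField (Place.Completion v))) (𝟙 _)
    (fun f m => (hι m f).symm) u x
  have h1 : cohomologyMap (𝟙 ((ρ.tateDual n).toLocal v).toTopRep) 1 u = u := by
    rw [show cohomologyMap (𝟙 ((ρ.tateDual n).toLocal v).toTopRep) 1 = 𝟙 _ from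
      map_id_eq_id _ (fun _ => rfl) 1]
    rfl
  have h2 : cohomologyMap (𝟙 ((mu K n).toLocal v).toTopRep) 2
      ((tateDualPairingLocal ρ n v).flip.cupProduct u x) =
        (tateDualPairingLocal ρ n v).flip.cupProduct u x := by
    rw [show cohomologyMap (𝟙 ((mu K n).toLocal v).toTopRep) 2 = 𝟙 _ from
      map_id_eq_id _ (fun _ => rfl) 2]
    rfl
  rw [h1, h2, DiscreteGaloisModule.cohomologyMap_homOfIntertwining] at h
  have h3 : (tateDualPairingLocal ρ n v).flip.cupProduct u x =
      -(tateDualPairingLocal ρ n v).cupProduct x u := by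
    rw [(tateDualPairingLocal ρ n v).cupProduct_comm x u, neg_neg]
  exact h.symm.trans h3

omit [NeZero n] in
/-- The same through an additive `inv_v : H²(K_v, μₙ) → ℤ/n`:
`inv_v(u ∪' H¹(ι_v) x) = -inv_v(x ∪ u)`. [cite: NeukirchSchmidtWingberg2008, I §4 (1.4.4)] -/
theorem localTatePairingZMod_tateDual_map_bidual [Finite (TateDual K M n)] (ρ : DiscreteGaloisModule K M)
    (ι : ρ.toContRepresentation →ⁱL ((ρ.tateDual n).tateDual n).toContRepresentation)
    (hι : ∀ (m : M) (f : TateDual K M n), ι m f = f m) (v : Place K)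
    (inv : galoisCohomology ((mu K n).toLocal v) 2 →+ ZMod n)
    (x : galoisCohomology (ρ.toLocal v) 1) (u : galoisCohomology ((ρ.tateDual n).toLocal v) 1) :
    localTatePairingZMod (ρ.tateDual n) n v inv u
        (galoisCohomology.map (ι.restrictField (Place.Completion v)) 1 x) =
      -localTatePairingZMod ρ n v inv x u := by
  rw [DiscreteGaloisModule.localTatePairingZMod_apply, DiscreteGaloisModule.localTatePairingZMod_apply,
    localTatePairing_tateDual_map_bidual ρ ι hι v x u, map_neg]

omit [NeZero n] in
/-- **`M^D` is unramified at `v ∤ n` where `M` is** (`GaloisRep.IsUnramifiedAt` form of n1011's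
`UnramifiedCup.toLocal_tateDual_apply_of_mem_absInertia_of_not_mem`). [cite: MilneADT2006, Ch. I §2, before Thm. 2.6] -/
theorem isUnramifiedAt_tateDual (ρ : DiscreteGaloisModule K M) (v : HeightOneSpectrum (𝓞 K))
    (hv : ((n : ℕ) : 𝓞 K) ∉ v.asIdeal) (hur : GaloisRep.IsUnramifiedAt v ρ) :
    GaloisRep.IsUnramifiedAt v (ρ.tateDual n) := by
  rw [GaloisRep.isUnramifiedAt_iff_toLocal_holds]
  intro σ hσ
  refine DFunLike.ext _ _ fun f => ?_
  rw [GaloisImage.UnramifiedCup.toLocal_tateDual_apply_of_mem_absInertia_of_not_mem ρ n v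
    hv hur hσ f]
  rfl

end LocalSign

section Transport

variable {K : Type u} [Field K] [NumberField K] {n : ℕ} [NeZero n]

/-- **Milne I Thm. 4.10(b) for `M^D`, read through `M^{DD} = M`, is the dual middle exactness for
`M`.**  If for EVERY finite `n`-torsion module the basic middle exactness holds for the family `inv`
(hypothesis `hE`, the shape consumed by `selmerComplement_of_middleExact`), then so does its dual form
`hE'` (`M` on the left of the pairing): given `u ∈ ⊕_{v∈S} H¹(K_v, M^D)` with
`∑_{v∈S} ⟨x_v, u_v⟩_v = 0` for all `x ∈ H¹(K, M)` unramified outside `S`, apply `hE` to `M^D` and `t = u`: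
every `z ∈ H¹(K, M^{DD})` unramified outside `S` is `H¹(ι) x` with `x = H¹(ι⁻¹) z` unramified outside
`S`, and `⟨u_v, (H¹(ι) x)_v⟩'_v = -⟨x_v, u_v⟩_v` (`localTatePairingZMod_tateDual_map_bidual`).
[cite: MilneADT2006, Ch. I, Thm. 4.10(b)] [cite: Howard2004HeegnerKolyvagin, Thm. 2.1.11 (arXiv:1202.6340 p. 6)] -/
theorem middleExact_dual_of_middleExact (inv : LocalInvariants K n)
    (hE : ∀ ⦃M : Type u⦄ [AddCommGroup M] [TopologicalSpace M] [DiscreteTopology M] [Finite M]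
      (ρ : DiscreteGaloisModule K M), (∀ m : M, n • m = 0) →
      ∀ S : Finset (Place K), (∀ w : InfinitePlace K, (Sum.inl w : Place K) ∈ S) →
        (∀ v : HeightOneSpectrum (𝓞 K), (Sum.inr v : Place K) ∉ S →
          ((n : ℕ) : 𝓞 K) ∉ v.asIdeal ∧ GaloisRep.IsUnramifiedAt v ρ) →
        ∀ t : Π v : Place K, galoisCohomology (ρ.toLocal v) 1,
          (∀ y : galoisCohomology (ρ.tateDual n) 1,
            (∀ v : HeightOneSpectrum (𝓞 K), (Sum.inr v : Place K) ∉ S →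
              galoisCohomology.localization (ρ.tateDual n) (Sum.inr v) 1 y ∈
                unramifiedSubgroup (GaloisRep.toLocal v (ρ.tateDual n)) 1) →
            ∑ v ∈ S, localTatePairingZMod ρ n v (inv v) (t v)
              (galoisCohomology.localization (ρ.tateDual n) v 1 y) = 0) →
          ∃ x : galoisCohomology ρ 1,
            (∀ v : HeightOneSpectrum (𝓞 K), (Sum.inr v : Place K) ∉ S →
              galoisCohomology.localization ρ (Sum.inr v) 1 x ∈
                unramifiedSubgroup (GaloisRep.toLocal v ρ) 1) ∧
            ∀ v ∈ S, galoisCohomology.localization ρ v 1 x = t v)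
    ⦃M : Type u⦄ [AddCommGroup M] [TopologicalSpace M] [DiscreteTopology M] [Finite M]
    (ρ : DiscreteGaloisModule K M) (hM : ∀ m : M, n • m = 0)
    (S : Finset (Place K)) (hinf : ∀ w : InfinitePlace K, (Sum.inl w : Place K) ∈ S)
    (hS : ∀ v : HeightOneSpectrum (𝓞 K), (Sum.inr v : Place K) ∉ S →
      ((n : ℕ) : 𝓞 K) ∉ v.asIdeal ∧ GaloisRep.IsUnramifiedAt v ρ)
    (u : Π v : Place K, galoisCohomology ((ρ.tateDual n).toLocal v) 1)
    (horth : ∀ x : galoisCohomology ρ 1,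
      (∀ v : HeightOneSpectrum (𝓞 K), (Sum.inr v : Place K) ∉ S →
        galoisCohomology.localization ρ (Sum.inr v) 1 x ∈ unramifiedSubgroup (GaloisRep.toLocal v ρ) 1) →
      ∑ v ∈ S, localTatePairingZMod ρ n v (inv v) (galoisCohomology.localization ρ v 1 x) (u v) = 0) :
    ∃ y : galoisCohomology (ρ.tateDual n) 1,
      (∀ v : HeightOneSpectrum (𝓞 K), (Sum.inr v : Place K) ∉ S →
        galoisCohomology.localization (ρ.tateDual n) (Sum.inr v) 1 y ∈
          unramifiedSubgroup (GaloisRep.toLocal v (ρ.tateDual n)) 1) ∧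
      ∀ v ∈ S, galoisCohomology.localization (ρ.tateDual n) v 1 y = u v := by
  haveI := DiscreteGaloisModule.TateDual.finite K M n
  haveI := DiscreteGaloisModule.TateDual.finite K (TateDual K M n) n
  obtain ⟨ι, κ, hι, hκι, hικ⟩ := exists_bidual_intertwining (n := n) ρ hM
  refine hE (ρ.tateDual n) (fun f => DiscreteGaloisModule.TateDual.nsmul_eq_zero f) S hinf
    (fun v hv => ⟨(hS v hv).1, isUnramifiedAt_tateDual ρ v (hS v hv).1 (hS v hv).2⟩) u fun z hz => ?_
  -- `z = H¹(ι) x` with `x = H¹(κ) z` unramified outside `S`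
  set x : galoisCohomology ρ 1 := galoisCohomology.map κ 1 z with hx_def
  have hzx : galoisCohomology.map ι 1 x = z := Levels.map_map_eq_self_of_comp_eq κ ι hικ z
  have hx : ∀ v : HeightOneSpectrum (𝓞 K), (Sum.inr v : Place K) ∉ S →
      galoisCohomology.localization ρ (Sum.inr v) 1 x ∈ unramifiedSubgroup (GaloisRep.toLocal v ρ) 1 :=
    fun v hv => by
      rw [hx_def, show galoisCohomology.localization ρ (Sum.inr v) 1 (galoisCohomology.map κ 1 z) =
        galoisCohomology.map (κ.restrictField (Place.Completion (Sum.inr v))) 1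
          (galoisCohomology.localization ((ρ.tateDual n).tateDual n) (Sum.inr v) 1 z) from
        galoisCohomology.res_map_one _ κ z]
      exact Levels.map_mem_unramifiedSubgroup _ (hz v hv)
  have h0 := horth x hx
  rw [← hzx]
  have hterm : ∀ v ∈ S, localTatePairingZMod (ρ.tateDual n) n v (inv v) (u v)
      (galoisCohomology.localization ((ρ.tateDual n).tateDual n) v 1 (galoisCohomology.map ι 1 x)) =
        -localTatePairingZMod ρ n v (inv v) (galoisCohomology.localization ρ v 1 x) (u v) := fun v _ => by
    rw [show galoisCohomology.localization ((ρ.tateDual n).tateDual n) v 1 (galoisCohomology.map ι 1 x) =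
        galoisCohomology.map (ι.restrictField (Place.Completion v)) 1 (galoisCohomology.localization ρ v 1 x)
      from galoisCohomology.res_map_one _ ι x]
    exact localTatePairingZMod_tateDual_map_bidual ρ ι hι v (inv v) _ _
  rw [Finset.sum_congr rfl hterm, Finset.sum_neg_distrib, h0, neg_zero]

end Transport

end Literature.NumberTheory.GaloisCohomology.PoitouTateFinite.PoitouTateReduction

end Part10

/-!
## Part 11 — port of `Summits/BirchSwinnertonDyer/BirchSwinnertonDyer/Theorems/SchneiderFreeAdditiveX3PoitouTateAllPlacesReduction.lean` (2 declarations kept)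

# Poitou–Tate toolkit: Milne I Thm. 4.10(b) `Ker γ¹ ⊆ Im β¹` at EVERY admissible finite set of places `S` (the Selmer form consumed by `poitouTate_selmerStructure_duality_of_middleExact_canonical`) FOLLOWS from the ALL-PLACES middle exactness

Declarations of this Part (verbatim port; each keeps its own docstring and citation): `exists_addMonoidHom_comp_eq_of_ker_le`, `middleExact_of_allPlaces`.

Reference keys (see `references.bib` and the declarations' citations): [Lam1999], [MilneADT2006], [Howard2004HeegnerKolyvagin].
-/

section Part11

open _root_.Function _root_.NumberField _root_.IsDedekindDomain
open scoped _root_.NumberField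

universe u

set_option autoImplicit false

namespace Literature.NumberTheory.GaloisCohomology.PoitouTateFinite.PoitouTateReduction

open _root_.Field
open Literature.NumberTheory.GaloisRepresentations Literature.NumberTheory.GaloisCohomology
open Literature.NumberTheory.GaloisRepresentations.DiscreteGaloisModule (mu TateDual tateDual
  localTatePairingZMod unramifiedSubgroup)
open Literature.AlgebraicTopology.SingularHomology (ZMod.baer_self)

section Extension

/-- **Every `ℤ/n`-valued additive functional defined on the image of a homomorphism into an
`n`-torsion abelian group extends to the whole group**: if `φ : Y → D`, `n·D = 0`, and `λ : Y → ℤ/n`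
vanishes on `ker φ`, then `λ = Λ ∘ φ` for some `Λ : D → ℤ/n`.  (`λ` descends to `Y/ker φ ↪ D`, and `ℤ/n` is an
injective `ℤ/n`-module — Baer's criterion, the tree's `ZMod.baer_self`.)
[cite: Lam1999, §15 (ℤ/nℤ is self-injective) and §3B Thm. 3.7] -/
theorem exists_addMonoidHom_comp_eq_of_ker_le {n : ℕ} [NeZero n] {Y D : Type*} [AddCommGroup Y]
    [AddCommGroup D] (hD : ∀ d : D, n • d = 0) (φ : Y →+ D) (lam : Y →+ ZMod n)
    (hker : ∀ y, φ y = 0 → lam y = 0) : ∃ Λ : D →+ ZMod n, ∀ y, Λ (φ y) = lam y := by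
  -- descend `λ` and `φ` to the quotient by `ker φ`
  let φ' : Y ⧸ φ.ker →+ D := QuotientAddGroup.kerLift φ
  have hφ' : Injective φ' := QuotientAddGroup.kerLift_injective φ
  let lam' : Y ⧸ φ.ker →+ ZMod n :=
    QuotientAddGroup.lift φ.ker lam fun y hy => (AddMonoidHom.mem_ker).2 (hker y hy)
  have hQ : ∀ q : Y ⧸ φ.ker, n • q = 0 := fun q => hφ' (by rw [map_nsmul, hD, map_zero])
  letI : Module (ZMod n) (Y ⧸ φ.ker) := AddCommGroup.zmodModule hQ
  letI : Module (ZMod n) D := AddCommGroup.zmodModule hD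
  obtain ⟨h, hh⟩ := (ZMod.baer_self n).extension_property (φ'.toZModLinearMap n) hφ'
    (lam'.toZModLinearMap n)
  refine ⟨h.toAddMonoidHom, fun y => ?_⟩
  have h1 := LinearMap.congr_fun hh (QuotientAddGroup.mk y)
  simp only [LinearMap.coe_comp, Function.comp_apply, AddMonoidHom.coe_toZModLinearMap] at h1
  rw [QuotientAddGroup.kerLift_mk] at h1
  rw [LinearMap.toAddMonoidHom_coe, h1]
  exact QuotientAddGroup.lift_mk _ _ y

end Extension

section AllPlaces

variable {K : Type u} [Field K] [NumberField K] {n : ℕ} [NeZero n]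
variable {M : Type u} [AddCommGroup M] [TopologicalSpace M] [DiscreteTopology M] [Finite M]

/-- **Milne I Thm. 4.10(b) `Ker γ¹ ⊆ Im β¹` at every admissible finite `S` from the ALL-PLACES middle
exactness.**  Let `inv` be a family of local invariant maps, perfect at the finite places (`IsPerfect`,
local Tate duality) and satisfying Milne I Thm. 2.6 (`UnramifiedOrthogonal`); `M` finite `n`-torsion.
Hypothesis `hA` (middle exactness of `H¹(K, M) → P¹(K, M) → H¹(K, M^D)^*`, `P¹` the restricted product over
ALL places): for every finite `T ⊇ {v ∣ ∞}` with `v ∉ T ⇒ v ∤ n ∧ M unramified at v` and every family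
`t = (t_v)_v` with `t_v ∈ H¹_ur(K_v, M)` for finite `v ∉ T`, if `∑_{v ∈ T'} inv_v(t_v ∪ loc_v y) = 0` for every
`y ∈ H¹(K, M^D)` and every finite `T' ⊇ T` outside which `y` is unramified, then `t = loc x` at every place for
some `x ∈ H¹(K, M)`.  Conclusion: for every finite `S ⊇ {v ∣ ∞}` with `v ∉ S ⇒ v ∤ n ∧ M unramified at v`,
every family `t` on `S` with `∑_{v∈S} inv_v(t_v ∪ loc_v y) = 0` for all `y ∈ H¹_S(K, M^D)` (unramified off `S`)
is `loc|_S x` for some `x ∈ H¹(K, M)` unramified off `S`.  Proof: extend `y ↦ ∑_{v∈S}⟨t_v, y_v⟩_v`, which kills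
`H¹_S(K, M^D) = ker(H¹(K, M^D) → ∏_{v∉S} H¹(K_v, M^D)/H¹_ur)`, to the product (`ℤ/n` self-injective); factor by
factor the extension is `⟨u_v, ·⟩_v` with `u_v` unramified (local duality + Thm. 2.6); apply `hA` to
`(t on S, −u off S)`. [cite: MilneADT2006, Ch. I, Thm. 4.10(b) and Thm. 2.6]
[cite: Howard2004HeegnerKolyvagin, Thm. 2.1.11 (arXiv:1202.6340 p. 6)] -/
theorem middleExact_of_allPlaces (inv : LocalInvariants K n) (hperf : inv.IsPerfect)
    (hUO : inv.UnramifiedOrthogonal) (ρ : DiscreteGaloisModule K M) (hM : ∀ m : M, n • m = 0)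
    (hA : ∀ T : Finset (Place K), (∀ w : InfinitePlace K, (Sum.inl w : Place K) ∈ T) →
      (∀ v : HeightOneSpectrum (𝓞 K), (Sum.inr v : Place K) ∉ T →
        ((n : ℕ) : 𝓞 K) ∉ v.asIdeal ∧ GaloisRep.IsUnramifiedAt v ρ) →
      ∀ t : Π v : Place K, galoisCohomology (ρ.toLocal v) 1,
        (∀ v : HeightOneSpectrum (𝓞 K), (Sum.inr v : Place K) ∉ T →
          t (Sum.inr v) ∈ unramifiedSubgroup (GaloisRep.toLocal v ρ) 1) →
        (∀ (y : galoisCohomology (ρ.tateDual n) 1) (T' : Finset (Place K)), T ⊆ T' →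
          (∀ v : HeightOneSpectrum (𝓞 K), (Sum.inr v : Place K) ∉ T' →
            galoisCohomology.localization (ρ.tateDual n) (Sum.inr v) 1 y ∈
              unramifiedSubgroup (GaloisRep.toLocal v (ρ.tateDual n)) 1) →
          ∑ v ∈ T', localTatePairingZMod ρ n v (inv v) (t v)
            (galoisCohomology.localization (ρ.tateDual n) v 1 y) = 0) →
        ∃ x : galoisCohomology ρ 1, ∀ v : Place K, galoisCohomology.localization ρ v 1 x = t v)
    {S : Finset (Place K)} (hinf : ∀ w : InfinitePlace K, (Sum.inl w : Place K) ∈ S)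
    (hS : ∀ v : HeightOneSpectrum (𝓞 K), (Sum.inr v : Place K) ∉ S →
      ((n : ℕ) : 𝓞 K) ∉ v.asIdeal ∧ GaloisRep.IsUnramifiedAt v ρ)
    (t : Π v : Place K, galoisCohomology (ρ.toLocal v) 1)
    (horth : ∀ y : galoisCohomology (ρ.tateDual n) 1,
      (∀ v : HeightOneSpectrum (𝓞 K), (Sum.inr v : Place K) ∉ S →
        galoisCohomology.localization (ρ.tateDual n) (Sum.inr v) 1 y ∈
          unramifiedSubgroup (GaloisRep.toLocal v (ρ.tateDual n)) 1) →
      ∑ v ∈ S, localTatePairingZMod ρ n v (inv v) (t v)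
        (galoisCohomology.localization (ρ.tateDual n) v 1 y) = 0) :
    ∃ x : galoisCohomology ρ 1,
      (∀ v : HeightOneSpectrum (𝓞 K), (Sum.inr v : Place K) ∉ S →
        galoisCohomology.localization ρ (Sum.inr v) 1 x ∈ unramifiedSubgroup (GaloisRep.toLocal v ρ) 1) ∧
      ∀ v ∈ S, galoisCohomology.localization ρ v 1 x = t v := by
  classical
  -- the local groups `H¹(K_v, M^D)` and their unramified subgroups, `v` finite
  let H : HeightOneSpectrum (𝓞 K) → Type u := fun v =>
    galoisCohomology ((ρ.tateDual n).toLocal (Sum.inr v)) 1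
  let U : Π v : HeightOneSpectrum (𝓞 K), AddSubgroup (H v) := fun v =>
    unramifiedSubgroup (GaloisRep.toLocal v (ρ.tateDual n)) 1
  let loc : Π v : HeightOneSpectrum (𝓞 K), galoisCohomology (ρ.tateDual n) 1 →+ H v := fun v =>
    galoisCohomology.localization (ρ.tateDual n) (Sum.inr v) 1
  -- the target product `D = ∏_v H¹(K_v, M^D)/H¹_ur` (all finite `v`; the `S`-components are zeroed below)
  let D : Type u := Π v : HeightOneSpectrum (𝓞 K), H v ⧸ U v
  have hD : ∀ d : D, n • d = 0 := by
    intro d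
    funext v
    obtain ⟨b, hb⟩ := QuotientAddGroup.mk_surjective (d v)
    rw [Pi.smul_apply, Pi.zero_apply, ← hb, ← QuotientAddGroup.mk_nsmul,
      galoisCohomology.nsmul_eq_zero_of_forall _ (fun f => DiscreteGaloisModule.TateDual.nsmul_eq_zero f) b,
      QuotientAddGroup.mk_zero]
  -- `locQ : H¹(K, M^D) → D`, `y ↦ (loc_v y mod H¹_ur)_{v ∉ S}` (zero at the finite places of `S`)
  let locQv : Π v : HeightOneSpectrum (𝓞 K), galoisCohomology (ρ.tateDual n) 1 →+ H v ⧸ U v := fun v =>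
    if (Sum.inr v : Place K) ∈ S then 0 else (QuotientAddGroup.mk' (U v)).comp (loc v)
  let locQ : galoisCohomology (ρ.tateDual n) 1 →+ D := AddMonoidHom.pi locQv
  have locQ_apply_of_mem : ∀ (y : galoisCohomology (ρ.tateDual n) 1) (v : HeightOneSpectrum (𝓞 K)),
      (Sum.inr v : Place K) ∈ S → locQ y v = 0 := fun y v hv => by
    change (locQv v) y = 0
    simp only [locQv, if_pos hv, AddMonoidHom.zero_apply]
  have locQ_apply_of_not_mem : ∀ (y : galoisCohomology (ρ.tateDual n) 1) (v : HeightOneSpectrum (𝓞 K)),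
      (Sum.inr v : Place K) ∉ S → locQ y v = QuotientAddGroup.mk (loc v y) := fun y v hv => by
    change (locQv v) y = _
    simp only [locQv, if_neg hv, AddMonoidHom.coe_comp, Function.comp_apply, QuotientAddGroup.coe_mk']
  -- the functional `λ(y) = ∑_{v ∈ S} ⟨t_v, loc_v y⟩_v`
  let lam : galoisCohomology (ρ.tateDual n) 1 →+ ZMod n :=
    ∑ v ∈ S, (localTatePairingZMod ρ n v (inv v) (t v)).comp
      (galoisCohomology.localization (ρ.tateDual n) v 1)
  have lam_apply : ∀ y, lam y = ∑ v ∈ S, localTatePairingZMod ρ n v (inv v) (t v)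
      (galoisCohomology.localization (ρ.tateDual n) v 1 y) := fun y => by
    simp only [lam, AddMonoidHom.finsetSum_apply, AddMonoidHom.coe_comp, Function.comp_apply]
  -- `λ` kills `ker locQ = H¹_S(K, M^D)`
  have hker : ∀ y, locQ y = 0 → lam y = 0 := by
    intro y hy
    rw [lam_apply]
    refine horth y fun v hv => ?_
    have h1 : locQ y v = 0 := by rw [hy]; rfl
    rw [locQ_apply_of_not_mem y v hv, QuotientAddGroup.eq_zero_iff] at h1
    exact h1
  -- extend `λ` to `Λ` on `D`
  obtain ⟨Λ, hΛ⟩ := exists_addMonoidHom_comp_eq_of_ker_le hD locQ lam hker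
  -- factor by factor, `Λ` is `⟨u_v, ·⟩_v` (local Tate duality)
  let F : Π v : HeightOneSpectrum (𝓞 K), H v →+ ZMod n := fun v =>
    Λ.comp ((AddMonoidHom.single (fun w => H w ⧸ U w) v).comp (QuotientAddGroup.mk' (U v)))
  have F_apply : ∀ (v : HeightOneSpectrum (𝓞 K)) (b : H v),
      F v b = Λ (Pi.single v (QuotientAddGroup.mk b : H v ⧸ U v)) := fun v b => rfl
  have F_apply_of_mem : ∀ (v : HeightOneSpectrum (𝓞 K)) (b : H v), b ∈ U v → F v b = 0 := by
    intro v b hb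
    rw [F_apply, (QuotientAddGroup.eq_zero_iff b).2 hb, Pi.single_zero, map_zero]
  choose u hu using fun v : HeightOneSpectrum (𝓞 K) => ((hperf v).2 ρ hM).1.2 (F v)
  -- `u_v` is unramified off `S` (Milne I 2.6)
  have hu_ur : ∀ v : HeightOneSpectrum (𝓞 K), (Sum.inr v : Place K) ∉ S →
      u v ∈ unramifiedSubgroup (GaloisRep.toLocal v ρ) 1 := by
    intro v hv
    refine (hUO ρ hM v (hS v hv).1 (hS v hv).2).2 (u v) fun b hb => ?_
    rw [hu v]
    exact F_apply_of_mem v b hb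
  -- the corrected family `t' = (t on S, -u off S)`
  let t' : Π v : Place K, galoisCohomology (ρ.toLocal v) 1 := fun v =>
    match v with
    | Sum.inl w => t (Sum.inl w)
    | Sum.inr v' => if (Sum.inr v' : Place K) ∈ S then t (Sum.inr v') else -u v'
  have ht'S : ∀ v ∈ S, t' v = t v := by
    intro v hv
    rcases v with w | v'
    · rfl
    · change (if (Sum.inr v' : Place K) ∈ S then t (Sum.inr v') else -u v') = _
      rw [if_pos hv]
  have ht'nS : ∀ v' : HeightOneSpectrum (𝓞 K), (Sum.inr v' : Place K) ∉ S → t' (Sum.inr v') = -u v' := by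
    intro v' hv'
    change (if (Sum.inr v' : Place K) ∈ S then t (Sum.inr v') else -u v') = _
    rw [if_neg hv']
  -- `t'` is orthogonal to ALL of `H¹(K, M^D)`
  have horth' : ∀ (y : galoisCohomology (ρ.tateDual n) 1) (T' : Finset (Place K)), S ⊆ T' →
      (∀ v : HeightOneSpectrum (𝓞 K), (Sum.inr v : Place K) ∉ T' →
        galoisCohomology.localization (ρ.tateDual n) (Sum.inr v) 1 y ∈
          unramifiedSubgroup (GaloisRep.toLocal v (ρ.tateDual n)) 1) →
      ∑ v ∈ T', localTatePairingZMod ρ n v (inv v) (t' v)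
        (galoisCohomology.localization (ρ.tateDual n) v 1 y) = 0 := by
    intro y T' hST' hyT'
    -- the finite places of `T' \ S`
    let P : Finset (HeightOneSpectrum (𝓞 K)) := (T' \ S).preimage Sum.inr (Sum.inr_injective.injOn)
    have hP : ∀ v' : HeightOneSpectrum (𝓞 K), v' ∈ P ↔ (Sum.inr v' : Place K) ∈ T' \ S := fun v' =>
      Finset.mem_preimage
    -- `locQ y` is supported on `P`
    have hsupp : (∑ v' ∈ P, Pi.single v' (locQ y v') : D) = locQ y := by
      funext w
      rw [Finset.sum_apply, Finset.sum_pi_single]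
      by_cases hw : w ∈ P
      · rw [if_pos hw]
      · rw [if_neg hw]
        by_cases hwS : (Sum.inr w : Place K) ∈ S
        · exact (locQ_apply_of_mem y w hwS).symm
        · have hwT' : (Sum.inr w : Place K) ∉ T' := fun h =>
            hw ((hP w).2 (Finset.mem_sdiff.2 ⟨h, hwS⟩))
          rw [locQ_apply_of_not_mem y w hwS, eq_comm, QuotientAddGroup.eq_zero_iff]
          exact hyT' w hwT'
    -- the sum over `T' \ S` is `-Λ(locQ y)`
    have hsdiff : ∑ v ∈ T' \ S, localTatePairingZMod ρ n v (inv v) (t' v)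
        (galoisCohomology.localization (ρ.tateDual n) v 1 y) = -Λ (locQ y) := by
      rw [← Finset.sum_preimage Sum.inr (T' \ S) Sum.inr_injective.injOn
        (fun v => localTatePairingZMod ρ n v (inv v) (t' v)
          (galoisCohomology.localization (ρ.tateDual n) v 1 y)) (fun v hv hrange => ?_)]
      · rw [← hsupp, map_sum, ← Finset.sum_neg_distrib]
        refine Finset.sum_congr rfl fun v' hv' => ?_
        have hv'S : (Sum.inr v' : Place K) ∉ S := (Finset.mem_sdiff.1 ((hP v').1 hv')).2
        rw [ht'nS v' hv'S, map_neg, AddMonoidHom.neg_apply, hu v', F_apply,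
          locQ_apply_of_not_mem y v' hv'S]
      · rcases v with w | v'
        · exact absurd (hinf w) (Finset.mem_sdiff.1 hv).2
        · exact absurd ⟨v', rfl⟩ hrange
    have hsum_S : ∑ v ∈ S, localTatePairingZMod ρ n v (inv v) (t' v)
        (galoisCohomology.localization (ρ.tateDual n) v 1 y) = lam y := by
      rw [lam_apply]
      exact Finset.sum_congr rfl fun v hv => by rw [ht'S v hv]
    rw [← Finset.sum_sdiff hST', hsdiff, hsum_S, hΛ y, neg_add_cancel]
  -- apply the all-places hypothesis
  obtain ⟨x, hx⟩ := hA S hinf hS t' (fun v' hv' => by rw [ht'nS v' hv']; exact neg_mem (hu_ur v' hv'))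
    horth'
  refine ⟨x, fun v' hv' => ?_, fun v hv => ?_⟩
  · rw [hx (Sum.inr v'), ht'nS v' hv']
    exact neg_mem (hu_ur v' hv')
  · rw [hx v, ht'S v hv]

end AllPlaces

end Literature.NumberTheory.GaloisCohomology.PoitouTateFinite.PoitouTateReduction

end Part11

/-!
## Part 12 — port of `Summits/BirchSwinnertonDyer/BirchSwinnertonDyer/Theorems/SchneiderFreeAdditiveX3PoitouTatePresentationReadout.lean` (5 declarations kept)

# Poitou–Tate toolkit: the presentation road INSTANTIATED — `hA` (all places, Tate duals) and hence `poitouTate_selmerStructure_duality K` from Tate duality for `(Γ_K, C̄)`, an idèle projection family, the idèle ASSEMBLY (R3) and the pairing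

Declarations of this Part (verbatim port; each keeps its own docstring and citation): `adjointMap_eq_zero_of_forall_inv`, `middleExact_allPlaces_of_readout_inv`, `middleExact_allPlaces_tateDual_of_ideleProjection`, `isUnramifiedAt_of_isUnramifiedAt_tateDual`, `exists_readout_eq_of_assembly`.

Reference keys (see `references.bib` and the declarations' citations): [Harari2020], [MilneADT2006], [CasselsFrohlichANT1967].
-/

section Part12

open _root_.Function _root_.NumberField _root_.IsDedekindDomain _root_.CategoryTheory CategoryTheory.Abelian
open scoped _root_.NumberField

set_option autoImplicit false

namespace Literature.NumberTheory.GaloisCohomology.PoitouTateFinite.PoitouTateReduction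

open _root_.Field
open Literature.NumberTheory.GaloisRepresentations Literature.NumberTheory.GaloisCohomology
open Literature.NumberTheory.GaloisRepresentations.DiscreteGaloisModule (mu TateDual tateDual
  localTatePairingZMod unramifiedSubgroup)
open Literature.Algebra.Homology Literature.Algebra.Homology.DiscreteRep Literature.Algebra.Homology.ExtPresentation
open Literature.NumberTheory.GaloisRepresentations.IdeleClassBar (classBarD)
open Literature.NumberTheory.GaloisRepresentations.FreePresentation (presentationComplex presentationComplex_shortExact
  ext_presLattice_unitsBarD_eq_zero presentationLayer presentationRank)
open Literature.NumberTheory.GaloisRepresentations.HomDual (IdeleProjection readout readout_f_comp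
  exists_forall_readout_comp_unitsToIdele_eq readoutInvariant localReadout localReadout_surjective
  exists_unitValued_localReadout_eq readout_eq_localReadout charZero_of_algebra)
open Literature.NumberTheory.GaloisRepresentations.FreePresentation (presModule₁ moduleFinite_presModule₁)
open Literature.NumberTheory.GaloisRepresentations.DGMBridge (LCarrier)

variable {K : Type} [Field K] [NumberField K]

section Inv

variable {n : ℕ} [NeZero n]
variable {M : Type} [AddCommGroup M] [TopologicalSpace M] [DiscreteTopology M] [Finite M]
variable (inv : Abelian.Ext (triv (Γ := absoluteGaloisGroup K) ℤ) (classBarD K) 2 →+ AddCircle (1 : ℚ))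

/-- `α¹_inv(∂ u) = 0` from the vanishing of all pairings, for an arbitrary invariant map `inv`.
[cite: Harari2020, §16.3][cite: MilneADT2006, Ch. I, Thm. 4.10 (proof)] -/
theorem adjointMap_eq_zero_of_forall_inv {S : ShortComplex (DiscreteRepCat ℤ (absoluteGaloisGroup K))}
    (x : Abelian.Ext S.X₃ (classBarD K) 1)
    (h : ∀ ŷ : Abelian.Ext (triv (Γ := absoluteGaloisGroup K) ℤ) S.X₃ 1, inv (ŷ.comp x (rfl : 1 + 1 = 2)) = 0) :
    ExtDuality.adjointMap (P := triv (Γ := absoluteGaloisGroup K) ℤ) inv S.X₃ (rfl : 1 + 1 = 2) x = 0 := by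
  ext ŷ
  rw [ExtDuality.pairing_apply, AddMonoidHom.zero_apply]
  exact h ŷ

/-- **Milne I Thm. 4.10(b), `r = 1`, `Ker γ¹ ⊆ Im β¹` over ALL places, from a presentation, `α¹`-injectivity for an
ARBITRARY invariant map `inv` of `C̄`, and a readout with (R1)–(R4)** — `middleExact_allPlaces_of_readout` with
`classBarInv K` replaced by `inv` throughout (same proof).
[cite: MilneADT2006, Ch. I, Lemma 4.13 and Thm. 4.10(b) (proof, p. 58)][cite: Harari2020, §17.3, Thm. 17.13] -/
theorem middleExact_allPlaces_of_readout_inv (ρ : DiscreteGaloisModule K M)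
    {S : ShortComplex (DiscreteRepCat ℤ (absoluteGaloisGroup K))} (hS : S.ShortExact)
    (hP : ∀ x : Abelian.Ext S.X₂ (ideleClassLimitShortComplex K).X₁ 1, x = 0)
    (hα : ExtDuality.AdjointInjective (P := triv (Γ := absoluteGaloisGroup K) ℤ) inv S.X₃ (rfl : 1 + 1 = 2))
    (R : ∀ v : Place K, (S.X₁ ⟶ (ideleClassLimitShortComplex K).X₂) →+ galoisCohomology (ρ.toLocal v) 1)
    (hR1 : ∀ (q : S.X₂ ⟶ (ideleClassLimitShortComplex K).X₂) (v : Place K), R v (S.f ≫ q) = 0)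
    (hR2 : ∀ h : S.X₁ ⟶ (ideleClassLimitShortComplex K).X₁, ∃ x : galoisCohomology ρ 1,
      ∀ v : Place K, R v (h ≫ (ideleClassLimitShortComplex K).f) = galoisCohomology.localization ρ v 1 x)
    (hR3 : ∀ T : Finset (Place K), (∀ w : InfinitePlace K, (Sum.inl w : Place K) ∈ T) →
      (∀ v : HeightOneSpectrum (𝓞 K), (Sum.inr v : Place K) ∉ T →
        ((n : ℕ) : 𝓞 K) ∉ v.asIdeal ∧ GaloisRep.IsUnramifiedAt v ρ) →
      ∀ t : Π v : Place K, galoisCohomology (ρ.toLocal v) 1,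
        (∀ v : HeightOneSpectrum (𝓞 K), (Sum.inr v : Place K) ∉ T →
          t (Sum.inr v) ∈ unramifiedSubgroup (GaloisRep.toLocal v ρ) 1) →
        ∃ f : S.X₁ ⟶ (ideleClassLimitShortComplex K).X₂, ∀ v : Place K, R v f = t v)
    (hR4 : ∀ (f : S.X₁ ⟶ (ideleClassLimitShortComplex K).X₂)
      (ŷ : Abelian.Ext (triv (Γ := absoluteGaloisGroup K) ℤ) S.X₃ 1) (T₀ : Finset (Place K)),
      ∃ (y : galoisCohomology (ρ.tateDual n) 1) (Ty : Finset (Place K)), T₀ ⊆ Ty ∧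
        (∀ v : HeightOneSpectrum (𝓞 K), (Sum.inr v : Place K) ∉ Ty →
          galoisCohomology.localization (ρ.tateDual n) (Sum.inr v) 1 y ∈
            unramifiedSubgroup (GaloisRep.toLocal v (ρ.tateDual n)) 1) ∧
        ((∀ T' : Finset (Place K), Ty ⊆ T' →
            ∑ v ∈ T', localTatePairingZMod ρ n v (LocalInvariants.canonical K n v) (R v f)
              (galoisCohomology.localization (ρ.tateDual n) v 1 y) = 0) →
          inv (ŷ.comp (boundary hS (classBarD K) (f ≫ (ideleClassLimitShortComplex K).g))
            (rfl : 1 + 1 = 2)) = 0)) :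
    ∀ T : Finset (Place K), (∀ w : InfinitePlace K, (Sum.inl w : Place K) ∈ T) →
      (∀ v : HeightOneSpectrum (𝓞 K), (Sum.inr v : Place K) ∉ T →
        ((n : ℕ) : 𝓞 K) ∉ v.asIdeal ∧ GaloisRep.IsUnramifiedAt v ρ) →
      ∀ t : Π v : Place K, galoisCohomology (ρ.toLocal v) 1,
        (∀ v : HeightOneSpectrum (𝓞 K), (Sum.inr v : Place K) ∉ T →
          t (Sum.inr v) ∈ unramifiedSubgroup (GaloisRep.toLocal v ρ) 1) →
        (∀ (y : galoisCohomology (ρ.tateDual n) 1) (T' : Finset (Place K)), T ⊆ T' →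
          (∀ v : HeightOneSpectrum (𝓞 K), (Sum.inr v : Place K) ∉ T' →
            galoisCohomology.localization (ρ.tateDual n) (Sum.inr v) 1 y ∈
              unramifiedSubgroup (GaloisRep.toLocal v (ρ.tateDual n)) 1) →
          ∑ v ∈ T', localTatePairingZMod ρ n v (LocalInvariants.canonical K n v) (t v)
            (galoisCohomology.localization (ρ.tateDual n) v 1 y) = 0) →
        ∃ x : galoisCohomology ρ 1, ∀ v : Place K, galoisCohomology.localization ρ v 1 x = t v := by
  intro T hinf hT t ht horth
  obtain ⟨f, hf⟩ := hR3 T hinf hT t ht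
  have hpair : ∀ ŷ : Abelian.Ext (triv (Γ := absoluteGaloisGroup K) ℤ) S.X₃ 1,
      inv (ŷ.comp (boundary hS (classBarD K) (f ≫ (ideleClassLimitShortComplex K).g)) (rfl : 1 + 1 = 2)) = 0 := by
    intro ŷ
    obtain ⟨y, Ty, hTTy, hyur, himp⟩ := hR4 f ŷ T
    refine himp fun T' hT' => ?_
    have h := horth y T' (hTTy.trans hT') fun v hv => hyur v fun hv' => hv (hT' hv')
    simpa only [hf] using h
  have h0 : boundary hS (classBarD K) (f ≫ (ideleClassLimitShortComplex K).g) = 0 :=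
    hα ((adjointMap_eq_zero_of_forall_inv inv _ hpair).trans (map_zero _).symm)
  obtain ⟨h, q, hfq⟩ := exists_eq_add_of_boundary_comp_eq_zero hS
    (ideleClassLimitShortComplex_shortExact K) hP f h0
  obtain ⟨x, hx⟩ := hR2 h
  refine ⟨x, fun v => ?_⟩
  rw [← hf v, hfq, map_add, hR1, add_zero, hx]

end Inv

section Instantiated

variable (inv : Abelian.Ext (triv (Γ := absoluteGaloisGroup K) ℤ) (classBarD K) 2 →+ AddCircle (1 : ℚ))

/-- **`hA(n, M₀^D)` — the all-places middle exactness for the TATE DUAL of a finite `n`-torsion `M₀` — from: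
Tate duality for `(Γ_K, C̄, inv)` (`TateDualityHypotheses`, door-c4), a family of idèle projections
`π v : J̄ → K̄_vˣ`, the (R3) SURJECTIVITY/ASSEMBLY statement for the readout `R_v = readout ρ₀ n hM (π v)` of the
canonical presentation of `ρ₀`, and the (R4) pairing dictionary for that readout.**  The other four inputs of the
road (`hS`, `hP`, `hR1`, `hR2`) are theorems (`presentationComplex_shortExact`, `ext_presLattice_unitsBarD_eq_zero`,
`readout_f_comp`, `exists_forall_readout_comp_unitsToIdele_eq`).
[cite: MilneADT2006, Ch. I, Lemma 4.13, Thm. 4.10(b) (proof, p. 58), Thm. 1.8][cite: Harari2020, §17.3, Thm. 17.13] -/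
theorem middleExact_allPlaces_tateDual_of_ideleProjection
    (hT : TateDualityHypotheses (classBarD K) inv) (π : ∀ v : Place K, IdeleProjection K v)
    {n : ℕ} [NeZero n] {M : Type} [AddCommGroup M] [TopologicalSpace M] [DiscreteTopology M] [Finite M]
    [Finite (TateDual K M n)] (ρ₀ : DiscreteGaloisModule K M) (hM : ∀ m : M, n • m = 0)
    (hR3 : ∀ T : Finset (Place K), (∀ w : InfinitePlace K, (Sum.inl w : Place K) ∈ T) →
      (∀ v : HeightOneSpectrum (𝓞 K), (Sum.inr v : Place K) ∉ T →
        ((n : ℕ) : 𝓞 K) ∉ v.asIdeal ∧ GaloisRep.IsUnramifiedAt v (ρ₀.tateDual n)) →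
      ∀ t : Π v : Place K, galoisCohomology ((ρ₀.tateDual n).toLocal v) 1,
        (∀ v : HeightOneSpectrum (𝓞 K), (Sum.inr v : Place K) ∉ T →
          t (Sum.inr v) ∈ unramifiedSubgroup (GaloisRep.toLocal v (ρ₀.tateDual n)) 1) →
        ∃ f : (presentationComplex ρ₀).X₁ ⟶ (ideleClassLimitShortComplex K).X₂,
          ∀ v : Place K, readout ρ₀ n hM (π v) f = t v)
    (hR4 : ∀ (f : (presentationComplex ρ₀).X₁ ⟶ (ideleClassLimitShortComplex K).X₂)
      (ŷ : Abelian.Ext (triv (Γ := absoluteGaloisGroup K) ℤ) (presentationComplex ρ₀).X₃ 1) (T₀ : Finset (Place K)),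
      ∃ (y : galoisCohomology ((ρ₀.tateDual n).tateDual n) 1) (Ty : Finset (Place K)), T₀ ⊆ Ty ∧
        (∀ v : HeightOneSpectrum (𝓞 K), (Sum.inr v : Place K) ∉ Ty →
          galoisCohomology.localization ((ρ₀.tateDual n).tateDual n) (Sum.inr v) 1 y ∈
            unramifiedSubgroup (GaloisRep.toLocal v ((ρ₀.tateDual n).tateDual n)) 1) ∧
        ((∀ T' : Finset (Place K), Ty ⊆ T' →
            ∑ v ∈ T', localTatePairingZMod (ρ₀.tateDual n) n v (LocalInvariants.canonical K n v)
              (readout ρ₀ n hM (π v) f)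
              (galoisCohomology.localization ((ρ₀.tateDual n).tateDual n) v 1 y) = 0) →
          inv (ŷ.comp (boundary (presentationComplex_shortExact ρ₀) (classBarD K)
            (f ≫ (ideleClassLimitShortComplex K).g)) (rfl : 1 + 1 = 2)) = 0)) :
    ∀ T : Finset (Place K), (∀ w : InfinitePlace K, (Sum.inl w : Place K) ∈ T) →
      (∀ v : HeightOneSpectrum (𝓞 K), (Sum.inr v : Place K) ∉ T →
        ((n : ℕ) : 𝓞 K) ∉ v.asIdeal ∧ GaloisRep.IsUnramifiedAt v (ρ₀.tateDual n)) →
      ∀ u : Π v : Place K, galoisCohomology ((ρ₀.tateDual n).toLocal v) 1,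
        (∀ v : HeightOneSpectrum (𝓞 K), (Sum.inr v : Place K) ∉ T →
          u (Sum.inr v) ∈ unramifiedSubgroup (GaloisRep.toLocal v (ρ₀.tateDual n)) 1) →
        (∀ (z : galoisCohomology ((ρ₀.tateDual n).tateDual n) 1) (T' : Finset (Place K)), T ⊆ T' →
          (∀ v : HeightOneSpectrum (𝓞 K), (Sum.inr v : Place K) ∉ T' →
            galoisCohomology.localization ((ρ₀.tateDual n).tateDual n) (Sum.inr v) 1 z ∈
              unramifiedSubgroup (GaloisRep.toLocal v ((ρ₀.tateDual n).tateDual n)) 1) →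
          ∑ v ∈ T', localTatePairingZMod (ρ₀.tateDual n) n v (LocalInvariants.canonical K n v) (u v)
            (galoisCohomology.localization ((ρ₀.tateDual n).tateDual n) v 1 z) = 0) →
        ∃ y : galoisCohomology (ρ₀.tateDual n) 1,
          ∀ v : Place K, galoisCohomology.localization (ρ₀.tateDual n) v 1 y = u v := by
  haveI := absoluteGaloisGroup_compactSpace K
  haveI : Finite (presentationComplex ρ₀).X₃.obj.V := ‹Finite M›
  have hα : ExtDuality.AdjointInjective (P := triv (Γ := absoluteGaloisGroup K) ℤ) inv (presentationComplex ρ₀).X₃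
      (rfl : 1 + 1 = 2) :=
    adjointMap_one_injective hT (presentationComplex ρ₀).X₃
  exact middleExact_allPlaces_of_readout_inv inv (ρ₀.tateDual n) (presentationComplex_shortExact ρ₀)
    (fun x => ext_presLattice_unitsBarD_eq_zero (presentationLayer ρ₀) (presentationRank ρ₀) x) hα
    (fun v => readout ρ₀ n hM (π v)) (fun q v => readout_f_comp ρ₀ n hM (π v) q)
    (fun h => exists_forall_readout_comp_unitsToIdele_eq ρ₀ n hM π h) hR3 hR4

end Instantiated

section Assembly

/-- **`ρ₀` is unramified at `v ∤ n` as soon as `ρ₀^D` is** (`M₀ ≅ M₀^{DD}`, `exists_bidual_intertwining`, and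
`isUnramifiedAt_tateDual` for `ρ₀^D`). [cite: MilneADT2006, Ch. I §2 (before Thm. 2.6), Prop. 0.19] -/
theorem isUnramifiedAt_of_isUnramifiedAt_tateDual {n : ℕ} [NeZero n]
    {M : Type} [AddCommGroup M] [TopologicalSpace M] [DiscreteTopology M] [Finite M] [Finite (TateDual K M n)]
    (ρ₀ : DiscreteGaloisModule K M) (hM : ∀ m : M, n • m = 0) (v : HeightOneSpectrum (𝓞 K))
    (hv : ((n : ℕ) : 𝓞 K) ∉ v.asIdeal) (hur : GaloisRep.IsUnramifiedAt v (ρ₀.tateDual n)) :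
    GaloisRep.IsUnramifiedAt v ρ₀ := by
  haveI := DiscreteGaloisModule.TateDual.finite K (TateDual K M n) n
  have h2 := isUnramifiedAt_tateDual (ρ₀.tateDual n) v hv hur
  obtain ⟨ι, κ, -, hκι, -⟩ := exists_bidual_intertwining (n := n) ρ₀ hM
  rw [GaloisRep.isUnramifiedAt_iff_toLocal_holds] at h2 ⊢
  intro σ hσ
  refine LinearMap.ext fun m => ?_
  have hιm : ι (ρ₀ (absGaloisRestrict K (v.adicCompletion K) σ) m) =
      ((ρ₀.tateDual n).tateDual n) (absGaloisRestrict K (v.adicCompletion K) σ) (ι m) := by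
    have h0 := congr($(ι.isIntertwining' (absGaloisRestrict K (v.adicCompletion K) σ)) m)
    simp only [ContinuousLinearMap.coe_comp, Function.comp_apply, ContinuousRep.toContRepresentation_apply_apply] at h0
    exact h0
  have h3 : ((ρ₀.tateDual n).tateDual n) (absGaloisRestrict K (v.adicCompletion K) σ) (ι m) = ι m := by
    have := LinearMap.congr_fun (h2 σ hσ) (ι m)
    rwa [GaloisRep.toLocal_apply] at this
  rw [GaloisRep.toLocal_apply, Module.End.one_apply, ← hκι (ρ₀ _ m), hιm, h3, hκι]

variable (inv : Abelian.Ext (triv (Γ := absoluteGaloisGroup K) ℤ) (classBarD K) 2 →+ AddCircle (1 : ℚ))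

/-- **(R3) from the local data and the idèle assembly.**  For the readout `R_v = readout ρ₀ n hM (π v)`:
if every family `(h_v)_v` of `Γ_{K_v}`-equivariant homomorphisms `N₁ → K̄_vˣ` that is UNIT-VALUED at the finite places
outside a finite set `T` is `(π_v ∘ f)_v` for one `f : N₁ ⟶ J̄` (the ASSEMBLY `Hom_{C_Γ}(N₁, J̄) = ∏'_v Hom_{Γ_{K_v}}(N₁, ·)`,
door-c5), then every admissible family of local classes `t ∈ P¹(K, ρ₀^D)` is `(R_v f)_v` — hypothesis `hR3` of the
road: the local classes are local readouts (`localReadout_surjective`), unit-valued at the unramified places outside `T`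
(`exists_unitValued_localReadout_eq`, with `ρ₀` unramified there by `isUnramifiedAt_of_isUnramifiedAt_tateDual`).
[cite: MilneADT2006, Ch. I, Lemma 4.13 (proof)][cite: CasselsFrohlichANT1967, Ch. VII §9.7] -/
theorem exists_readout_eq_of_assembly (π : ∀ v : Place K, IdeleProjection K v)
    {n : ℕ} [NeZero n] {M : Type} [AddCommGroup M] [TopologicalSpace M] [DiscreteTopology M] [Finite M]
    [Finite (TateDual K M n)] (ρ₀ : DiscreteGaloisModule K M) (hM : ∀ m : M, n • m = 0)
    (hAsm : ∀ (T : Finset (Place K))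
      (h : ∀ v : Place K, (haveI := moduleFinite_presModule₁ ρ₀
        (homGaloisModule ((presModule₁ ρ₀).restrictField (Place.Completion v))
          (DiscreteGaloisModule.units (Place.Completion v))).toTopRep.ρ.invariants)),
      (∀ v : HeightOneSpectrum (𝓞 K), (Sum.inr v : Place K) ∉ T → ∀ x : LCarrier (presentationComplex ρ₀).X₁,
        IsNonarchimedeanLocalField.ordQ (v.adicCompletion K)
          ((show LCarrier (presentationComplex ρ₀).X₁ →ₗ[ℤ] DiscreteGaloisModule.UnitsCarrier (v.adicCompletion K) from
            ((h (Sum.inr v)).1 : DiscreteRep.HomCarrier (LCarrier (presentationComplex ρ₀).X₁)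
              (DiscreteGaloisModule.UnitsCarrier (v.adicCompletion K)))) x) = 0) →
      ∃ f : (presentationComplex ρ₀).X₁ ⟶ (ideleClassLimitShortComplex K).X₂, ∀ v : Place K,
        (haveI := moduleFinite_presModule₁ ρ₀; readoutInvariant (π v) (presentationComplex ρ₀).X₁ f) = h v) :
    ∀ T : Finset (Place K), (∀ w : InfinitePlace K, (Sum.inl w : Place K) ∈ T) →
      (∀ v : HeightOneSpectrum (𝓞 K), (Sum.inr v : Place K) ∉ T →
        ((n : ℕ) : 𝓞 K) ∉ v.asIdeal ∧ GaloisRep.IsUnramifiedAt v (ρ₀.tateDual n)) →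
      ∀ t : Π v : Place K, galoisCohomology ((ρ₀.tateDual n).toLocal v) 1,
        (∀ v : HeightOneSpectrum (𝓞 K), (Sum.inr v : Place K) ∉ T →
          t (Sum.inr v) ∈ unramifiedSubgroup (GaloisRep.toLocal v (ρ₀.tateDual n)) 1) →
        ∃ f : (presentationComplex ρ₀).X₁ ⟶ (ideleClassLimitShortComplex K).X₂,
          ∀ v : Place K, readout ρ₀ n hM (π v) f = t v := by
  intro T _ hT t ht
  haveI := moduleFinite_presModule₁ ρ₀
  -- local data at the finite places: unit-valued outside `T`
  have hfin : ∀ v : HeightOneSpectrum (𝓞 K),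
      ∃ hv : (homGaloisModule ((presModule₁ ρ₀).restrictField (Place.Completion (Sum.inr v : Place K)))
          (DiscreteGaloisModule.units (Place.Completion (Sum.inr v : Place K)))).toTopRep.ρ.invariants,
        (haveI : CharZero (Place.Completion (Sum.inr v : Place K)) :=
            charZero_of_algebra (K := K) (Place.Completion (Sum.inr v : Place K));
          localReadout ρ₀ n hM (Place.Completion (Sum.inr v : Place K)) hv) = t (Sum.inr v) ∧
        ((Sum.inr v : Place K) ∉ T → ∀ x : LCarrier (presentationComplex ρ₀).X₁,
          IsNonarchimedeanLocalField.ordQ (v.adicCompletion K)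
            ((show LCarrier (presentationComplex ρ₀).X₁ →ₗ[ℤ] DiscreteGaloisModule.UnitsCarrier (v.adicCompletion K) from
              (hv.1 : DiscreteRep.HomCarrier (LCarrier (presentationComplex ρ₀).X₁)
                (DiscreteGaloisModule.UnitsCarrier (v.adicCompletion K)))) x) = 0) := by
    intro v
    haveI : CharZero (v.adicCompletion K) := charZero_of_algebra (K := K) (v.adicCompletion K)
    -- move `t_v` to the `v.adicCompletion K`-spelling of `K_v` (definitional) before using the local lemmas
    set tv : galoisCohomology ((ρ₀.tateDual n).restrictField (v.adicCompletion K)) 1 := t (Sum.inr v) with htv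
    by_cases hvT : (Sum.inr v : Place K) ∈ T
    · obtain ⟨h, hh⟩ := localReadout_surjective ρ₀ n hM (v.adicCompletion K) tv
      exact ⟨h, hh, fun hvT' => (hvT' hvT).elim⟩
    · obtain ⟨hnv, hurD⟩ := hT v hvT
      have htv' : tv ∈ unramifiedSubgroup ((ρ₀.tateDual n).restrictField (v.adicCompletion K)) 1 := ht v hvT
      obtain ⟨h, hh, hord⟩ := exists_unitValued_localReadout_eq ρ₀ n hM v
        (isUnramifiedAt_of_isUnramifiedAt_tateDual ρ₀ hM v hnv hurD) tv htv'
      exact ⟨h, hh, fun _ => hord⟩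
  -- local data at the infinite places
  have hinf : ∀ w : InfinitePlace K,
      ∃ hv : (homGaloisModule ((presModule₁ ρ₀).restrictField (Place.Completion (Sum.inl w : Place K)))
          (DiscreteGaloisModule.units (Place.Completion (Sum.inl w : Place K)))).toTopRep.ρ.invariants,
        (haveI : CharZero (Place.Completion (Sum.inl w : Place K)) :=
            charZero_of_algebra (K := K) (Place.Completion (Sum.inl w : Place K));
          localReadout ρ₀ n hM (Place.Completion (Sum.inl w : Place K)) hv) = t (Sum.inl w) := by
    intro w
    haveI : CharZero (Place.Completion (Sum.inl w : Place K)) :=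
      charZero_of_algebra (K := K) (Place.Completion (Sum.inl w : Place K))
    exact localReadout_surjective ρ₀ n hM (Place.Completion (Sum.inl w : Place K)) (t (Sum.inl w))
  choose hf hhf hunit using hfin
  choose hi hhi using hinf
  -- assembly
  obtain ⟨f, hf⟩ := hAsm T (fun v => Sum.rec (motive := fun v : Place K =>
      (homGaloisModule ((presModule₁ ρ₀).restrictField (Place.Completion v))
        (DiscreteGaloisModule.units (Place.Completion v))).toTopRep.ρ.invariants) hi hf v)
    (fun v hv x => hunit v hv x)
  refine ⟨f, fun v => ?_⟩
  rw [readout_eq_localReadout, hf v]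
  rcases v with w | v
  · exact hhi w
  · exact hhf v

end Assembly

end Literature.NumberTheory.GaloisCohomology.PoitouTateFinite.PoitouTateReduction

end Part12

/-!
## Part 13 — port of `Summits/BirchSwinnertonDyer/BirchSwinnertonDyer/Theorems/KolyvaginRoadThreePTDevissageCofinite.lean` (3 declarations kept)

# A global class is LOCALLY unramified at almost every place (Milne I Lemma 4.8, local form)

Declarations of this Part (verbatim port; each keeps its own docstring and citation): `localization_mem_unramifiedSubgroup_of_forall_inertia`, `eventually_localization_mem_unramifiedSubgroup`, `exists_finset_localization_mem_unramifiedSubgroup`.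

Reference keys (see `references.bib` and the declarations' citations): [MilneADT2006], [NeukirchANT1999].
-/

section Part13

open _root_.CategoryTheory _root_.Function _root_.NumberField _root_.IsDedekindDomain
open scoped _root_.NumberField

universe u

set_option autoImplicit false

namespace Literature.NumberTheory.GaloisCohomology.PoitouTateFinite.KolyvaginRoadThreePT

open _root_.Field _root_.Filter
open Literature.NumberTheory.GaloisRepresentations
open Literature.NumberTheory.GaloisRepresentations.DiscreteGaloisModule (unramifiedSubgroup)
open _root_.TopRep _root_.ContinuousCohomology
open Literature.NumberTheory.GaloisCohomology.PoitouTateFinite.LocBridge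

variable {K : Type u} [Field K] [NumberField K] {M : Type u} [AddCommGroup M] [TopologicalSpace M]
  [DiscreteTopology M]

/-- **`loc_v c ∈ H¹_ur(K_v, M)` whenever the cocycle vanishes on every inertia group above `v`.**
For a continuous crossed homomorphism `f : Γ_K → M` vanishing on `I_𝔓` for the prime `𝔓 = 𝔓_v` of
`K̄` cut out by the completion, the localisation of `[f]` at `v` is unramified: `f ∘ res` vanishes on
the local inertia group `I_{K_v}`, whose image is `I_𝔓` (Neukirch II (9.6)).
[cite: NeukirchANT1999, Ch. II §9 Prop. (9.6)] [cite: MilneADT2006, Ch. I §4, Lemma 4.8] -/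
theorem localization_mem_unramifiedSubgroup_of_forall_inertia (ρ : DiscreteGaloisModule K M)
    (f : contOneCocycles ρ.toTopRep) (v : HeightOneSpectrum (𝓞 K))
    (hf : ∀ g ∈ (adicCompletionPrime K v).inertia (absoluteGaloisGroup K), f.1 g = 0) :
    galoisCohomology.localization ρ (Sum.inr v) 1 (oneCocycleClass ρ.toTopRep f) ∈
      unramifiedSubgroup (GaloisRep.toLocal v ρ) 1 := by
  -- unramified classes of the local module: principal on the local inertia group
  have key : ∀ φ' : contOneCocycles (DiscreteGaloisModule.toTopRep (GaloisRep.toLocal v ρ)),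
      (∀ τ, φ'.1 τ = f.1 (absGaloisRestrict K (v.adicCompletion K) τ)) →
      oneCocycleClass _ φ' ∈ unramifiedSubgroup (GaloisRep.toLocal v ρ) 1 := by
    intro φ' hφ'
    rw [mem_unramifiedSubgroup_one_iff_exists]
    refine ⟨0, fun τ hτ => ?_⟩
    rw [hφ', map_zero, sub_zero]
    apply hf
    rw [inertia_adicCompletionPrime_eq_map_absInertia]
    exact Subgroup.mem_map_of_mem _ hτ
  have h1 : galoisCohomology.localization ρ (Sum.inr v) 1 (oneCocycleClass ρ.toTopRep f) =
      oneCocycleClass (DiscreteGaloisModule.toTopRep (GaloisRep.toLocal v ρ))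
        (contOneCocycles.pullback (absGaloisRestrict K (v.adicCompletion K))
          (X := ρ.toTopRep) (Y := DiscreteGaloisModule.toTopRep (GaloisRep.toLocal v ρ))
          (TopRep.ofHom ⟨ContinuousLinearMap.id ℤ M, fun _ => rfl⟩) f) :=
    galoisCohomology.res_one_oneCocycleClass (v.adicCompletion K) f
  rw [h1]
  exact key _ fun τ => rfl

/-- **Milne I Lemma 4.8, local form: a global class is locally unramified at almost every place.**
For `c ∈ H¹(K, M)` (`K` a number field, `M` a discrete `Γ_K`-module), for all but finitely many
finite places `v` the localisation `loc_v c` lies in `H¹_ur(K_v, M)` (the unramified subgroup of the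
local module `GaloisRep.toLocal v ρ`).  [cite: MilneADT2006, Ch. I §4, Lemma 4.8] -/
theorem eventually_localization_mem_unramifiedSubgroup (ρ : DiscreteGaloisModule K M)
    (c : galoisCohomology ρ 1) :
    ∀ᶠ v : HeightOneSpectrum (𝓞 K) in cofinite,
      galoisCohomology.localization ρ (Sum.inr v) 1 c ∈ unramifiedSubgroup (GaloisRep.toLocal v ρ) 1 := by
  classical
  obtain ⟨f, rfl⟩ := oneCocycleClass_surjective ρ.toTopRep c
  -- the zero locus of the cocycle is a neighbourhood of `1`
  have hV : {γ : absoluteGaloisGroup K | f.1 γ = 0} ∈ nhds (1 : absoluteGaloisGroup K) := by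
    refine IsOpen.mem_nhds ?_ ?_
    · exact (isOpen_discrete ({0} : Set M)).preimage f.1.continuous
    · exact contOneCocycles.apply_one f
  -- a finite normal subextension `E/K` with `f = 0` on `Gal(K̄/E)`
  obtain ⟨E, hEfin, hEnormal, hEV⟩ :=
    (krullTopology_mem_nhds_one_iff_of_normal K (AlgebraicClosure K) _).1 hV
  haveI := hEfin
  haveI := hEnormal
  haveI : IsGalois K E := IsGalois.mk
  -- at almost all `v`, every inertia group above `v` fixes `E`
  filter_upwards [eventually_forall_inertia_mem_fixingSubgroup (F := K) E] with v hv
  refine localization_mem_unramifiedSubgroup_of_forall_inertia ρ f v fun g hg => ?_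
  exact hEV (hv _ (adicCompletionPrime_mem_primesAbove K v) g hg)

/-- **Finite-set form**: for `c ∈ H¹(K, M)` there is a finite set `T` of finite places outside which
`loc_v c` is unramified. [cite: MilneADT2006, Ch. I §4, Lemma 4.8] -/
theorem exists_finset_localization_mem_unramifiedSubgroup (ρ : DiscreteGaloisModule K M)
    (c : galoisCohomology ρ 1) :
    ∃ T : Finset (HeightOneSpectrum (𝓞 K)), ∀ v ∉ T,
      galoisCohomology.localization ρ (Sum.inr v) 1 c ∈ unramifiedSubgroup (GaloisRep.toLocal v ρ) 1 := by
  have h := eventually_localization_mem_unramifiedSubgroup ρ c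
  rw [Filter.eventually_cofinite] at h
  refine ⟨h.toFinset, fun v hv => ?_⟩
  by_contra hc
  exact hv (h.mem_toFinset.2 hc)

end Literature.NumberTheory.GaloisCohomology.PoitouTateFinite.KolyvaginRoadThreePT

end Part13

/-!
## Part 14 — port of `Summits/BirchSwinnertonDyer/BirchSwinnertonDyer/Theorems/SchneiderFreeAdditiveX3PoitouTateReciprocityEquality.lean` (6 declarations kept)

# The (R4) RECIPROCITY EQUALITY of the `Ш²`-readout road to PT2, for THE idèle projections, THE canonical invariant maps and the bijection `nat := −Φ⁻¹ ∘ H¹(κ)` (Milne *ADT* I Thm. 4.10 (a), proof p. 58; Tate, Cassels–Fröhlich VII §11.2 (bis)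

Declarations of this Part (verbatim port; each keeps its own docstring and citation): `inflatedClass_eq_extOneToGaloisCohomology_inflG`, `map_map_eq_of_comp_eq`, `map_bijective_of_bidual`, `neg_extOneEquiv_symm_map_bijective`, `nat_bijective`, `hR4_ideleProjection_of_readoutUnramified`.

Reference keys (see `references.bib` and the declarations' citations): [SerreGaloisCohomology1997], [MilneADT2006], [CasselsFrohlichANT1967].
-/

section Part14

open _root_.Function _root_.NumberField _root_.IsDedekindDomain _root_.CategoryTheory CategoryTheory.Abelian groupCohomology
open scoped _root_.NumberField ContRepresentation

set_option autoImplicit false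

namespace Literature.NumberTheory.GaloisCohomology.PoitouTateFinite.PoitouTateReduction

open _root_.Field
open Literature.NumberTheory.GaloisRepresentations Literature.NumberTheory.GaloisCohomology
open Literature.NumberTheory.GaloisRepresentations.DiscreteGaloisModule (mu TateDual tateDual localTatePairingZMod
  localTatePairingZMod_apply unramifiedSubgroup)
open Literature.Algebra.Homology Literature.Algebra.Homology.DiscreteRep Literature.Algebra.Homology.ExtPresentation
open Literature.NumberTheory.GaloisRepresentations.IdeleClassBar (classBarD classBarInv GalLayer)
open Literature.NumberTheory.GaloisRepresentations.FreePresentation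
open Literature.NumberTheory.GaloisRepresentations.HomDual (IdeleProjection readout readoutInvariant localReadout
  readout_eq_localReadout charZero_of_algebra equivariantMap restrictIntertwining isSES_restrict)
open Literature.NumberTheory.GaloisRepresentations.DGMBridge (LCarrier)
open Literature.NumberTheory.GaloisRepresentations.IdeleReadout (ideleProjection layerEmb)
open Literature.NumberTheory.GaloisRepresentations.OpenLayer (extOneToGaloisCohomology extOneEquiv
  extOneToGaloisCohomology_inflG_H1π_eq_of_apply extOneToGaloisCohomology_bijective extOneToGaloisCohomology_symm_apply)
open Literature.NumberTheory.Automorphic (IdeleClassGroup.ideleRep)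
open Literature.AnabelianGeometry.AbsoluteAnabelian.Prop121vii (zmodToQmodZ brauerInvariantEquiv)
open Literature.NumberTheory.GaloisCohomology.PoitouTateFinite.GaloisImage.UnramifiedCup (unramifiedSubgroup_tateDual_le_dualLocalCondition')

variable {K : Type} [Field K] [NumberField K]

/-! ## §1 The dictionary: door-c4's inflated class IS `Φ` of the inflated layer class -/

/-- **`inflatedClass ρ₀ h γ = Φ (Inf_E [γ])`**: door-c4's explicit inflated class `[σ ↦ γ(σ̄)] ∈ H¹(K, M)` of a layer `1`-cocycle `γ`
of `M^{U_E}` is the value of door-c5's inflation bijection `Φ` on the layer class `Inf_E [γ] ∈ Ext¹_{C_Γ}(ℤ, M)` (both are the class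
of the cocycle `σ ↦ γ(σ̄)`: `pushCocycle_liftCont_apply`, `extOneToGaloisCohomology_inflG_H1π_eq_of_apply`).
[cite: SerreGaloisCohomology1997, I §2.2 Proposition 8][cite: MilneADT2006, I Thm. 4.10 (proof, p. 58)] -/
theorem inflatedClass_eq_extOneToGaloisCohomology_inflG
    {M : Type} [AddCommGroup M] [TopologicalSpace M] [DiscreteTopology M] [Finite M] (ρ₀ : DiscreteGaloisModule K M)
    {E : GalLayer K} (h : presentationLayer ρ₀ ≤ E)
    (γ : cocycles₁ ((invariantsQuotFunctor ℤ (E.openNormalSubgroup : Subgroup (absoluteGaloisGroup K))).obj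
      (presentationComplex ρ₀).X₃)) :
    inflatedClass ρ₀ h γ =
      extOneToGaloisCohomology ρ₀ (LayerColimit.inflG E.openNormalSubgroup (presentationComplex ρ₀).X₃ 1 ((H1π _) γ)) :=
  (extOneToGaloisCohomology_inflG_H1π_eq_of_apply ρ₀ E.openNormalSubgroup γ
    (IsSES.pushCocycle (liftCont ρ₀ h γ) (liftCont_crossed ρ₀ h γ)) (pushCocycle_liftCont_apply ρ₀ h γ)).symm

/-! ## §2 `nat := −(Φ⁻¹ ∘ H¹(κ))` is bijective -/

omit [NumberField K] in
/-- `H¹(ι) (H¹(κ) y) = y` for a biduality pair with `ι ∘ κ = id`. [cite: MilneADT2006, I Prop. 0.19] -/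
theorem map_map_eq_of_comp_eq {M M' : Type} [AddCommGroup M] [TopologicalSpace M] [DiscreteTopology M]
    [AddCommGroup M'] [TopologicalSpace M'] [DiscreteTopology M']
    {ρ : DiscreteGaloisModule K M} {ρ' : DiscreteGaloisModule K M'}
    (ι : ρ.toContRepresentation →ⁱL ρ'.toContRepresentation) (κ : ρ'.toContRepresentation →ⁱL ρ.toContRepresentation)
    (hικ : ∀ m' : M', ι (κ m') = m') (y : galoisCohomology ρ' 1) :
    galoisCohomology.map ι 1 (galoisCohomology.map κ 1 y) = y := by
  obtain ⟨φ, rfl⟩ := oneCocycleClass_surjective _ y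
  rw [galoisCohomology.map_one_oneCocycleClass, galoisCohomology.map_one_oneCocycleClass]
  exact congrArg (oneCocycleClass _) (Subtype.ext (ContinuousMap.ext fun σ => hικ (φ.1 σ)))

omit [NumberField K] in
/-- `H¹(κ)` is bijective for a biduality pair `(ι, κ)`. [cite: MilneADT2006, I Prop. 0.19] -/
theorem map_bijective_of_bidual {M M' : Type} [AddCommGroup M] [TopologicalSpace M] [DiscreteTopology M]
    [AddCommGroup M'] [TopologicalSpace M'] [DiscreteTopology M']
    {ρ : DiscreteGaloisModule K M} {ρ' : DiscreteGaloisModule K M'}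
    (ι : ρ.toContRepresentation →ⁱL ρ'.toContRepresentation) (κ : ρ'.toContRepresentation →ⁱL ρ.toContRepresentation)
    (hκι : ∀ m : M, κ (ι m) = m) (hικ : ∀ m' : M', ι (κ m') = m') :
    Bijective (galoisCohomology.map κ 1) := by
  refine Function.bijective_iff_has_inverse.2 ⟨galoisCohomology.map ι 1, fun y => ?_, fun x => ?_⟩
  · exact map_map_eq_of_comp_eq ι κ hικ y
  · exact map_map_eq_of_comp_eq κ ι hκι x

omit [NumberField K] in
/-- `y ↦ −Φ⁻¹(H¹(κ) y)` is bijective (as a bare function). [cite: MilneADT2006, I Thm. 4.10 (proof, p. 58), Prop. 0.19]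
[cite: SerreGaloisCohomology1997, I §2.2 Proposition 8] -/
theorem neg_extOneEquiv_symm_map_bijective {n : ℕ} [NeZero n]
    {M : Type} [AddCommGroup M] [TopologicalSpace M] [DiscreteTopology M] [Finite M] [Finite (TateDual K M n)]
    (ρ₀ : DiscreteGaloisModule K M)
    (ι : ρ₀.toContRepresentation →ⁱL ((ρ₀.tateDual n).tateDual n).toContRepresentation)
    (κ : ((ρ₀.tateDual n).tateDual n).toContRepresentation →ⁱL ρ₀.toContRepresentation)
    (hκι : ∀ m : M, κ (ι m) = m) (hικ : ∀ φ : TateDual K (TateDual K M n) n, ι (κ φ) = φ) :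
    Bijective (fun y : galoisCohomology ((ρ₀.tateDual n).tateDual n) 1 =>
      -((extOneEquiv ρ₀).symm (galoisCohomology.map κ 1 y))) :=
  neg_bijective.comp ((extOneEquiv ρ₀).symm.bijective.comp (map_bijective_of_bidual ι κ hκι hικ))

/-- **`nat := −(Φ⁻¹ ∘ H¹(κ)) : H¹(K, M^{DD}) →+ Ext¹_{C_Γ}(ℤ, M)` is bijective** — the hypothesis `hnat` of
`shaTwo_tateDual_of_ideleProjection` for the additive map `nat` of `hR4_ideleProjection_of_readoutUnramified` (written with an
`AddMonoidHom.id` on `Ext¹(ℤ, (presentationComplex ρ₀).X₃)` so that its target is literally the road's).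
[cite: MilneADT2006, I Thm. 4.10 (proof, p. 58), Prop. 0.19][cite: SerreGaloisCohomology1997, I §2.2 Proposition 8] -/
theorem nat_bijective {n : ℕ} [NeZero n]
    {M : Type} [AddCommGroup M] [TopologicalSpace M] [DiscreteTopology M] [Finite M] [Finite (TateDual K M n)]
    (ρ₀ : DiscreteGaloisModule K M)
    (ι : ρ₀.toContRepresentation →ⁱL ((ρ₀.tateDual n).tateDual n).toContRepresentation)
    (κ : ((ρ₀.tateDual n).tateDual n).toContRepresentation →ⁱL ρ₀.toContRepresentation)
    (hκι : ∀ m : M, κ (ι m) = m) (hικ : ∀ φ : TateDual K (TateDual K M n) n, ι (κ φ) = φ) :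
    Bijective (-((AddMonoidHom.id (Abelian.Ext (triv (Γ := absoluteGaloisGroup K) ℤ) (presentationComplex ρ₀).X₃ 1)).comp
      (((extOneEquiv ρ₀).symm.toAddMonoidHom).comp (galoisCohomology.map κ 1)))) :=
  neg_extOneEquiv_symm_map_bijective ρ₀ ι κ hκι hικ

/-! ## §3 The (R4) reciprocity EQUALITY for the idèle projections, modulo `hRur` -/

set_option maxHeartbeats 1600000 in
/-- **The (R4) reciprocity equality** — VERBATIM the hypothesis `hR4` of `PoitouTateShaTwoReadout.shaTwo_tateDual_of_ideleProjection`
for `π := IdeleReadout.ideleProjection K`, `inv := classBarInv K` and `nat := −(Φ⁻¹ ∘ H¹(κ))` — for every number field `K`, every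
level `n ≥ 1`, every finite `n`-torsion `ρ₀` and every biduality pair `(ι, κ)`, GIVEN `hRur`: the readout `R_v f` of each
`f : N₁ → J̄` is unramified at every finite place off a finite set `Tf` off which moreover `v ∤ n` and `M^D` is unramified.
See the module docstring for the chain of tree theorems. [cite: MilneADT2006, I Thm. 4.10 (a) (proof, p. 58), Lemma 4.13, Prop. 0.19]
[cite: CasselsFrohlichANT1967, Ch. VII §11.2 (bis), §7.3 Cor. 7.4 (b)] -/
theorem hR4_ideleProjection_of_readoutUnramified {n : ℕ} [NeZero n]
    {M : Type} [AddCommGroup M] [TopologicalSpace M] [DiscreteTopology M] [Finite M] [Finite (TateDual K M n)]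
    (ρ₀ : DiscreteGaloisModule K M) (hM : ∀ m : M, n • m = 0)
    (ι : ρ₀.toContRepresentation →ⁱL ((ρ₀.tateDual n).tateDual n).toContRepresentation)
    (κ : ((ρ₀.tateDual n).tateDual n).toContRepresentation →ⁱL ρ₀.toContRepresentation)
    (hι : ∀ (m : M) (g : TateDual K M n), ι m g = g m) (hκι : ∀ m : M, κ (ι m) = m)
    (hικ : ∀ φ : TateDual K (TateDual K M n) n, ι (κ φ) = φ)
    (hRur : ∀ f : (presentationComplex ρ₀).X₁ ⟶ (ideleClassLimitShortComplex K).X₂, ∃ Tf : Finset (Place K),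
      ∀ v : HeightOneSpectrum (𝓞 K), (Sum.inr v : Place K) ∉ Tf →
        ((n : ℕ) : 𝓞 K) ∉ v.asIdeal ∧ GaloisRep.IsUnramifiedAt v (ρ₀.tateDual n) ∧
          readout ρ₀ n hM (ideleProjection K (Sum.inr v)) f ∈
            unramifiedSubgroup (GaloisRep.toLocal v (ρ₀.tateDual n)) 1) :
    ∀ f : (presentationComplex ρ₀).X₁ ⟶ (ideleClassLimitShortComplex K).X₂, ∃ Tf : Finset (Place K),
      ∀ (y : galoisCohomology ((ρ₀.tateDual n).tateDual n) 1) (T' : Finset (Place K)), Tf ⊆ T' →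
        (∀ v : HeightOneSpectrum (𝓞 K), (Sum.inr v : Place K) ∉ T' →
          galoisCohomology.localization ((ρ₀.tateDual n).tateDual n) (Sum.inr v) 1 y ∈
            unramifiedSubgroup (GaloisRep.toLocal v ((ρ₀.tateDual n).tateDual n)) 1) →
        zmodToQmodZ n (∑ v ∈ T', localTatePairingZMod (ρ₀.tateDual n) n v (LocalInvariants.canonical K n v)
          (readout ρ₀ n hM (ideleProjection K v) f)
          (galoisCohomology.localization ((ρ₀.tateDual n).tateDual n) v 1 y)) =
        classBarInv K (((-((AddMonoidHom.id (Abelian.Ext (triv (Γ := absoluteGaloisGroup K) ℤ) (presentationComplex ρ₀).X₃ 1)).comp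
            (((extOneEquiv ρ₀).symm.toAddMonoidHom).comp (galoisCohomology.map κ 1)))) y).comp
          (boundary (presentationComplex_shortExact ρ₀) (classBarD K)
            (f ≫ (ideleClassLimitShortComplex K).g)) (rfl : 1 + 1 = 2)) := by
  haveI : TotallyDisconnectedSpace (absoluteGaloisGroup K) := inferInstance
  intro f
  classical
  obtain ⟨Tf₀, hTf₀⟩ := hRur f
  -- `Tf`: the exceptional set of `hRur` together with all infinite places
  refine ⟨Tf₀ ∪ Finset.univ.image Sum.inl, fun y T' hT' hy => ?_⟩
  have hinf : ∀ w : InfinitePlace K, (Sum.inl w : Place K) ∈ T' := fun w =>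
    hT' (Finset.mem_union_right _ (Finset.mem_image_of_mem _ (Finset.mem_univ w)))
  have hTf₀T' : ∀ v : HeightOneSpectrum (𝓞 K), (Sum.inr v : Place K) ∉ T' → (Sum.inr v : Place K) ∉ Tf₀ :=
    fun v hv h => hv (hT' (Finset.mem_union_left _ h))
  haveI := moduleFinite_presModule₁ ρ₀
  haveI := moduleFinite_presModule₂ ρ₀
  have hκ : ∀ (Φ : TateDual K (TateDual K M n) n) (g : TateDual K M n), Φ g = g (κ Φ) := fun Φ g => by
    conv_lhs => rw [← hικ Φ]
    exact hι (κ Φ) g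
  -- the global class `x := H¹(κ) y` and its `Ext`-avatar `ŷ := Φ⁻¹ x`
  set x : galoisCohomology ρ₀ 1 := galoisCohomology.map κ 1 y with hx
  have hιx : galoisCohomology.map ι 1 x = y := map_map_eq_of_comp_eq ι κ hικ y
  set ŷ : Abelian.Ext (triv (Γ := absoluteGaloisGroup K) ℤ) (presentationComplex ρ₀).X₃ 1 := (extOneEquiv ρ₀).symm x with hŷ
  have hΦŷ : extOneToGaloisCohomology ρ₀ ŷ = x := extOneToGaloisCohomology_symm_apply ρ₀ x
  -- a layer `E ⊇ K(M)` and a layer cocycle `γ` with `Inf_E [γ] = ŷ`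
  obtain ⟨E, hE, c, hc⟩ := exists_layer_ge_inflG_eq (presentationLayer ρ₀) (presentationComplex ρ₀).X₃ 1 ŷ
  have hsurj : ∀ c' : groupCohomology ((invariantsQuotFunctor ℤ
      (E.openNormalSubgroup : Subgroup (absoluteGaloisGroup K))).obj (presentationComplex ρ₀).X₃) 1,
      ∃ γ : cocycles₁ ((invariantsQuotFunctor ℤ (E.openNormalSubgroup : Subgroup (absoluteGaloisGroup K))).obj
        (presentationComplex ρ₀).X₃), (H1π _) γ = c' := fun c' =>
    H1_induction_on (C := fun c' => ∃ γ : cocycles₁ ((invariantsQuotFunctor ℤ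
      (E.openNormalSubgroup : Subgroup (absoluteGaloisGroup K))).obj (presentationComplex ρ₀).X₃), (H1π _) γ = c') c'
      fun γ => ⟨γ, rfl⟩
  obtain ⟨γ, rfl⟩ := hsurj c
  -- the inflated class of `γ` IS `x`
  have hxγ : inflatedClass ρ₀ hE γ = x := by
    rw [inflatedClass_eq_extOneToGaloisCohomology_inflG, hc, hΦŷ]
  -- door-c4's idèle cocycle `b` with (P1)
  obtain ⟨b, T, hb, hP1, -⟩ := exists_cocycle_classBarInv_eq_inv ρ₀ hE ((H1π _) γ) f
  haveI := E.numberField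
  haveI := E.isGalois
  haveI := E.finiteDimensional
  -- every finite local invariant of `[b]` is minus the local pairing term
  have hfin : ∀ v : HeightOneSpectrum (𝓞 K),
      IdeleCohomology.localInv E.1 v ((H2π (IdeleClassGroup.ideleRep K E.1)) b) =
        - zmodToQmodZ n (localTatePairingZMod (ρ₀.tateDual n) n (Sum.inr v) (LocalInvariants.canonical K n (Sum.inr v))
          (readout ρ₀ n hM (ideleProjection K (Sum.inr v)) f)
          (galoisCohomology.localization ((ρ₀.tateDual n).tateDual n) (Sum.inr v) 1 y)) := by
    intro v
    haveI : CharZero (v.adicCompletion K) := charZero_of_algebra (K := K) (v.adicCompletion K)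
    have key := HomDual.zmodToQmodZ_localTatePairingZMod_localReadout_global ρ₀ n hM v ι κ hκι hκ
      (readoutInvariant (ideleProjection K (Sum.inr v)) (presentationComplex ρ₀).X₁ f) x
    rw [hιx] at key
    have hP3 := localInv_H2π_eq_brauerInvariantEquiv ρ₀ hE v γ f b hb
    rw [hxγ] at hP3
    rw [hP3]
    exact (neg_eq_iff_eq_neg.mp key.symm)
  -- every archimedean local invariant of `[b]` is minus the local pairing term
  have hinfv : ∀ w : InfinitePlace K,
      IdeleCohomology.localInvInf E.1 w ((H2π (IdeleClassGroup.ideleRep K E.1)) b) =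
        - zmodToQmodZ n (localTatePairingZMod (ρ₀.tateDual n) n (Sum.inl w) (LocalInvariants.canonical K n (Sum.inl w))
          (readout ρ₀ n hM (ideleProjection K (Sum.inl w)) f)
          (galoisCohomology.localization ((ρ₀.tateDual n).tateDual n) (Sum.inl w) 1 y)) := by
    intro w
    haveI : CompactSpace (absoluteGaloisGroup w.Completion) := absoluteGaloisGroup_compactSpace _
    have hP4 : w.IsReal →
        (twoCocycleClass (DiscreteGaloisModule.units w.Completion).toTopRep
            ((IdeleCohomology.archReadoutPair w (layerEmb E)).pull b) = 0 ↔
          cohomologyMap (toTopRepHom ((presModule₁ ρ₀).restrictField w.Completion) (DiscreteGaloisModule.units w.Completion)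
              (equivariantMap ((presModule₁ ρ₀).restrictField w.Completion) (DiscreteGaloisModule.units w.Completion)
                (readoutInvariant (ideleProjection K (Sum.inl w)) (presentationComplex ρ₀).X₁ f))) 2
            (galoisCohomology.res (presModule₁ ρ₀) w.Completion 2 ((pres_isSES ρ₀).δ₁ x)) = 0) := fun _ => by
      rw [← hxγ]
      exact iff_of_eq (congrArg (fun t => t = 0) (twoCocycleClass_archReadoutPair_pull_eq ρ₀ hE w γ f b hb))
    have key := HomDual.localInvInf_H2π_eq_neg_zmodToQmodZ_localTatePairingZMod_localReadout ρ₀ n hM w (layerEmb E) b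
      ι κ hκι hκ (readoutInvariant (ideleProjection K (Sum.inl w)) (presentationComplex ρ₀).X₁ f) x hP4
    rw [hιx] at key
    exact key
  -- off `T'` the local pairing terms vanish (unramified classes are orthogonal), hence so do the local invariants
  have hzero : ∀ v : HeightOneSpectrum (𝓞 K), (Sum.inr v : Place K) ∉ T' →
      localTatePairingZMod (ρ₀.tateDual n) n (Sum.inr v) (LocalInvariants.canonical K n (Sum.inr v))
          (readout ρ₀ n hM (ideleProjection K (Sum.inr v)) f)
          (galoisCohomology.localization ((ρ₀.tateDual n).tateDual n) (Sum.inr v) 1 y) = 0 := by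
    intro v hv
    obtain ⟨hvn, hur, hRv⟩ := hTf₀ v (hTf₀T' v hv)
    have hle := unramifiedSubgroup_tateDual_le_dualLocalCondition' (ρ₀.tateDual n) n v
      (LocalInvariants.canonical K n) hvn hur
    exact (LocalInvariants.mem_dualLocalCondition_iff (LocalInvariants.canonical K n) (ρ₀.tateDual n) (Sum.inr v) _ _).1
      (hle (hy v hv)) _ hRv
  have hT : ∀ v : HeightOneSpectrum (𝓞 K), (Sum.inr v : Place K) ∉ T' →
      IdeleCohomology.localInv E.1 v ((H2π (IdeleClassGroup.ideleRep K E.1)) b) = 0 := fun v hv => by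
    rw [hfin v, hzero v hv, map_zero, neg_zero]
  -- the right-hand side: `classBarInv (nat y ∘ ∂) = − inv_E [b] = − Σ_{T'} (local invariants)`
  have hnat : (-((AddMonoidHom.id (Abelian.Ext (triv (Γ := absoluteGaloisGroup K) ℤ) (presentationComplex ρ₀).X₃ 1)).comp
      (((extOneEquiv ρ₀).symm.toAddMonoidHom).comp (galoisCohomology.map κ 1)))) y =
      -(LayerColimit.inflG E.openNormalSubgroup (presentationComplex ρ₀).X₃ 1 ((H1π _) γ)) := by
    rw [hc]
    rfl
  have hneg : ∀ a : Abelian.Ext (triv (Γ := absoluteGaloisGroup K) ℤ) (presentationComplex ρ₀).X₃ 1,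
      classBarInv K ((-a).comp (boundary (presentationComplex_shortExact ρ₀) (classBarD K)
        (f ≫ (ideleClassLimitShortComplex K).g)) (rfl : 1 + 1 = 2)) =
      - classBarInv K (a.comp (boundary (presentationComplex_shortExact ρ₀) (classBarD K)
        (f ≫ (ideleClassLimitShortComplex K).g)) (rfl : 1 + 1 = 2)) := fun a => by
    rw [← map_neg]
    exact congrArg (classBarInv K) (Ext.neg_comp a _ _)
  rw [hnat, hneg, hP1,
    IdeleCohomology.inv_eq_sum_place (E := E.1) ((H2π (IdeleClassGroup.ideleRep K E.1)) b) T' hinf hT,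
    ← Finset.sum_neg_distrib, map_sum]
  refine Finset.sum_congr rfl ?_
  rintro (w | v) -
  · change _ = - IdeleCohomology.localInvInf E.1 w ((H2π (IdeleClassGroup.ideleRep K E.1)) b)
    rw [hinfv w, neg_neg]
  · change _ = - IdeleCohomology.localInv E.1 v ((H2π (IdeleClassGroup.ideleRep K E.1)) b)
    rw [hfin v, neg_neg]

end Literature.NumberTheory.GaloisCohomology.PoitouTateFinite.PoitouTateReduction

end Part14

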